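import Literature.Computability.Cryptography.OrderFindingPostSpec
import Literature.Computability.Complexity.StackLists
import Literature.Computability.Complexity.StackUnary
import Literature.Computability.Complexity.StackRoutines
import HarnessLib

/-!
# Shor's order-finding post-processor is polynomial time, II: Kitaev's refinement in integers

Family `PQC` (trunk `CryptoQuantFine`); the second of the four `FP` stages of
`orderFindingPost` (`ShorOrderFindingQuantum.lean`; plan in `OrderFindingPostCounts.lean`,
specification in `OrderFindingPostSpec.lean`):

  `stageA2 : ⟨N, ⟨U, κ-bits⟩⟩ ↦ ⟨N, ⟨1^{|U|}, ⟨A₀, ⟨A₁, ⟨A₂, A₃⟩⟩⟩⟩⟩`,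

where, for each trial `t < 4`, `A_t = refineNat κ_t L (L − 1)` (`L = 2|U| + 1` levels) is the
numerator of Kitaev's iterated halving (Kitaev 1995, §3, Lemma 10: of the two halves of the
current estimate keep the one closer, on the circle, to the next level's quadrant centre
`κ/8`), computed exactly in integers over the denominators `8 · 2^d` (`OFPostCF.refineNat`),
the level numerators `κ_t(l) = kq c s ∈ {1, 3, 5, 7}` being read off the two test bits `c, s`
of level `l` of trial `t` in the third input component (two bits per level, `2L` per trial).

Contents: the structured stack program `prog` over `K ⊕ AReg` (the arithmetic bank of
`StackArith.lean` for `add`/`sub`/`normalize`; all other registers hold unary counters, bit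
stacks and numerals moved in and out of the bank), its closed form `stageA2`, the simulation
`runs_prog` (parser by association-list register files, kernel by the structured file `kf`),
and `stageA2_mem_FP` (`Com.mem_FP`, `StackPrograms.lean`).

## References

* A. Yu. Kitaev, *Quantum measurements and the Abelian Stabilizer Problem*,
  arXiv:quant-ph/9511026 (1995), §3, Lemma 10.
* S. Arora, B. Barak, *Computational Complexity: A Modern Approach*, CUP 2009, §1.3.
-/

noncomputable section

namespace Literature.Computability.Cryptography

namespace OFPostA2

open _root_.Computability Complexity Complexity.Com Kitaev1995 Complexity.AReg OFPostCF

/-! ### The closed form of the stage -/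

/-- The level numerators of trial `t` read off the bit string `kp` (cosine bit, then sine bit,
per level; `2L` bits per trial; missing bits read `0`). [cite: Kitaev1995, §3 (before Lemma 9)] -/
def kapOf (L : ℕ) (kp : List Bool) (t l : ℕ) : ℕ :=
  kq (kp.getD (2 * L * t + 2 * l) false) (kp.getD (2 * L * t + 2 * l + 1) false)

/-- The refined numerator of trial `t`. [cite: Kitaev1995, §3 Lemma 10] -/
def aOf (L : ℕ) (kp : List Bool) (t : ℕ) : ℕ := refineNat (kapOf L kp t) L (L - 1)

/-- **Stage A2 of the post-processor.** [folklore] -/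
def stageA2 (z : List Bool) : List Bool :=
  let N := (boolUnpair z).1
  let ℓ := (boolUnpair (boolUnpair z).2).1.length
  let kp := (boolUnpair (boolUnpair z).2).2
  let L := numLevels ℓ
  boolPair N (boolPair (ones ℓ) (boolPair (encodeNat (aOf L kp 0)) (boolPair (encodeNat (aOf L kp 1))
    (boolPair (encodeNat (aOf L kp 2)) (encodeNat (aOf L kp 3))))))

/-! ### Registers -/

/-- The program's own registers (besides the arithmetic bank `AReg`). [folklore] -/
inductive K where
  | inp | A | T | M1 | P1 | W | A2 | T2 | M2 | P2 | NN | L | LV | LC | KP | KS | DC | CC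
  | AA | V | NB | HF | W1 | MA | MB | T1 | Tx | OUT | RES
  deriving DecidableEq, Fintype

/-- The register type of the program. [folklore] -/
abbrev RR := K ⊕ AReg

/-- An own register. [folklore] -/
abbrev o (k : K) : RR := Sum.inl k

/-- A register file given by an association list (newest write first); generic form of
`OrdPost.mk` (`ShorOrdPost.lean`). [folklore] -/
def fileOf {ι : Type} [DecidableEq ι] (l : List (ι × List Bool)) : Regs ι := fun r => (l.lookup r).getD []

section FileOf

variable {ι : Type} [DecidableEq ι]

/-- Writing into an association-list file prepends. [folklore] -/
theorem update_fileOf (l : List (ι × List Bool)) (k : ι) (v : List Bool) :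
    Function.update (fileOf l) k v = fileOf ((k, v) :: l) := by
  funext r
  by_cases h : r = k
  · subst h; simp [fileOf, List.lookup]
  · rw [Function.update_of_ne h]
    have hb : (r == k) = false := beq_false_of_ne h
    simp [fileOf, List.lookup, hb]

/-- Reading the empty file. [folklore] -/
@[simp] theorem fileOf_nil (r : ι) : fileOf ([] : List (ι × List Bool)) r = [] := rfl

/-- Reading past one entry. [folklore] -/
theorem fileOf_cons (k : ι) (v : List Bool) (l : List (ι × List Bool)) (r : ι) :
    fileOf ((k, v) :: l) r = if r = k then v else fileOf l r := by
  by_cases h : r = k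
  · subst h; simp [fileOf, List.lookup]
  · have hb : (r == k) = false := beq_false_of_ne h
    simp [fileOf, List.lookup, hb, h]

/-- The initial register file as an association list. [folklore] -/
theorem init_eq_fileOf (inp : ι) (z : List Bool) : Regs.init inp z = fileOf [(inp, z)] := by
  funext r
  by_cases h : r = inp
  · subst h; simp [Regs.init, fileOf, List.lookup]
  · have hb : (r == inp) = false := beq_false_of_ne h
    simp [Regs.init, h, fileOf, List.lookup, hb]

end FileOf

/-! ### Macros over the bank -/

/-- `x := r` (bank `x` empty before). [folklore] -/
def ldx (r : K) : Com RR := copy (o r) (Sum.inr .x) (o .T1) (o .Tx)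
/-- `y := r` (bank `y` empty before). [folklore] -/
def ldy (r : K) : Com RR := copy (o r) (Sum.inr .y) (o .T1) (o .Tx)
/-- `r := x, x := []` (`r` empty before). [folklore] -/
def stx (r : K) : Com RR := move (Sum.inr .x) (o r) (o .T1)
/-- `x := x + r`. [folklore] -/
def addR (r : K) : Com RR := ldy r ;; (bk add ;; clear (Sum.inr .y))
/-- `x := x ∸ r` if `x ≥ r` (else unchanged), flag discarded. [folklore] -/
def subR (r : K) : Com RR := ldy r ;; (bk sub ;; (clear (Sum.inr .y) ;; clear (Sum.inr .g)))
/-- `g := [x ≥ r]`, `x` discarded. [folklore] -/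
def cmpR (r : K) : Com RR := ldy r ;; (bk sub ;; (clear (Sum.inr .y) ;; clear (Sum.inr .x)))
/-- Prepend `|DC|` zeros to `r` (multiply by `2^{|DC|}`). [folklore] -/
def shl (r : K) : Com RR := copy (o .DC) (o .CC) (o .T1) (o .Tx) ;; loop (o .CC) (push (o r) false) (push (o r) false)
/-- `r := 2^{|DC| + e}` (`r` empty before). [folklore] -/
def mkPow (r : K) (e : ℕ) : Com RR := push (o r) true ;; (pushN (o r) false e ;; shl r)

/-! ### The program -/

/-- Pop the two test bits of the next level off `KS` (sine bit on top, then cosine bit; missing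
bits read `0`) and push the numeral of `kq c s ∈ {1, 7, 3, 5}` onto the empty register `V`.
[cite: Kitaev1995, §3 (before Lemma 9)] -/
def mkK : Com RR :=
  pop (o .KS)
    (pop (o .KS) (push (o .V) true) (push (o .V) true ;; push (o .V) true) (push (o .V) true ;; push (o .V) true))
    (pop (o .KS) (pushN (o .V) true 3) (push (o .V) true ;; (push (o .V) false ;; push (o .V) true))
      (push (o .V) true ;; (push (o .V) false ;; push (o .V) true)))
    (pop (o .KS) (pushN (o .V) true 3) (push (o .V) true ;; (push (o .V) false ;; push (o .V) true))
      (push (o .V) true ;; (push (o .V) false ;; push (o .V) true)))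

/-- The modular distance of `x + N − v (mod N)` into register `m` (`x` holds `a` or `a + N/2`;
`NB = N`, `HF = N/2`, `V = v`): subtract `v` from `x + N`, reduce below `N`, save as `W1`, compare
with `N/2`, and store `N − w` or `w`. [cite: Kitaev1995, §3 Lemma 10] -/
def distC (m : K) : Com RR :=
  addR .NB ;; (subR .V ;; (subR .NB ;; (stx .W1 ;; (ldx .W1 ;; (cmpR .HF ;;
  pop (Sum.inr .g) (ldx .NB ;; (subR .W1 ;; (stx m ;; clear (o .W1)))) skip (move (o .W1) (o m) (o .T1)))))))

/-- Set-up of a refinement step at depth `d + 1 = |DC|`: the level numerator `k`, then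
`V := k · 2^{d+1}`, `NB := 2^{d+4}`, `HF := 2^{d+3}`. [cite: Kitaev1995, §3 Lemma 10] -/
def setupC : Com RR := mkK ;; (shl .V ;; (mkPow .NB 3 ;; mkPow .HF 2))

/-- The two modular distances (from `a` into `MA`, from `a + N/2` into `MB`) and their comparison
`g := [MA ≤ MB]`. [cite: Kitaev1995, §3 Lemma 10] -/
def distsC : Com RR :=
  ldx .AA ;; (distC .MA ;; (ldx .AA ;; (addR .HF ;; (distC .MB ;; (ldx .MB ;; cmpR .MA)))))

/-- Keep `a` (flag set) or replace it by the normalised numeral of `a + N/2`.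
[cite: Kitaev1995, §3 Lemma 10] -/
def branchC : Com RR :=
  pop (Sum.inr .g) skip skip (ldx .AA ;; (addR .HF ;; (clear (o .AA) ;; (bk normalize ;; stx .AA))))

/-- Reset the scratch registers of a step and count the depth up. [folklore] -/
def cleanC : Com RR :=
  clear (o .V) ;; (clear (o .NB) ;; (clear (o .HF) ;; (clear (o .MA) ;; (clear (o .MB) ;; push (o .DC) true))))

/-- **One refinement step** (depth `d + 1 ↦ d + 2`). [cite: Kitaev1995, §3 Lemma 10] -/
def stepC : Com RR := setupC ;; (distsC ;; (branchC ;; cleanC))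

/-- Move the next test bit from the stream `KP` onto the stack `KS` (an exhausted stream reads
`0`). [folklore] -/
def rd2 : Com RR := pop (o .KP) (push (o .KS) true) (push (o .KS) false) (push (o .KS) false)

/-- Read the `2|LC|` test bits of a trial onto the stack `KS` (reversing them). [folklore] -/
def readC : Com RR := loop (o .LC) (rd2 ;; rd2) (rd2 ;; rd2)

/-- **The kernel of one trial**: read its `2L` bits, level `0` (`a := κ(L−1)`, `|DC| := 1`), then
`L − 1 = 2ℓ` refinement steps. [cite: Kitaev1995, §3 Lemma 10] -/
def trialCore : Com RR :=
  copy (o .LV) (o .LC) (o .T1) (o .Tx) ;; (push (o .LC) true ;; (readC ;;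
  (mkK ;; (move (o .V) (o .AA) (o .T1) ;; (push (o .DC) true ;;
  (copy (o .LV) (o .LC) (o .T1) (o .Tx) ;; loop (o .LC) stepC stepC))))))

/-- One trial: the kernel, then hand the numeral `AA` to `fin` and reset the depth. [folklore] -/
def trialC (fin : Com RR) : Com RR := trialCore ;; (fin ;; clear (o .DC))

/-- **The parser**: unpair twice, `N` to `NN`, `ℓ` and `2ℓ` in unary, the bits to `KP`, and emit
the first two output components. [folklore] -/
def parse : Com RR :=
  unpairW (o .inp) (o .A) (o .T) (o .M1) (o .P1) ;; (pour (o .A) (o .NN) ;; (pour (o .T) (o .W) ;;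
  (unpairW (o .W) (o .A2) (o .T2) (o .M2) (o .P2) ;; (addReg (o .A2) (o .L) (o .T1) ;; (clear (o .A2) ;;
  (pour (o .T2) (o .KP) ;; (addReg (o .L) (o .LV) (o .T1) ;; (addReg (o .L) (o .LV) (o .T1) ;;
  (emit (o .NN) (o .OUT) ;; (copy (o .L) (o .LC) (o .T1) (o .Tx) ;; emit (o .LC) (o .OUT)))))))))))

/-- **The whole program.** [folklore] -/
def prog : Com RR :=
  parse ;; (trialC (emit (o .AA) (o .OUT)) ;; (trialC (emit (o .AA) (o .OUT)) ;; (trialC (emit (o .AA) (o .OUT)) ;;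
  (trialC (pour (o .AA) (o .OUT)) ;; pour (o .OUT) (o .RES)))))

/-! ### Simulation of the macros -/

section Macros

attribute [-simp] Sum.elim_update_left Sum.elim_update_right

variable (T : K → List Bool)

/-- The state shape between macros: own registers `T`, bank `x`, `y`, flag `g`. [folklore] -/
abbrev S (T : K → List Bool) (x y g : List Bool) : Regs RR := Sum.elim T (file x y [] [] [] [] [] g)

/-- Rewriting a register twice around a write elsewhere. [folklore] -/
theorem upd3 (T : K → List Bool) {r c : K} (hrc : r ≠ c) (u v w : List Bool) :
    Function.update (Function.update (Function.update T r u) c w) r v = Function.update (Function.update T r v) c w := by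
  funext k
  simp only [Function.update_apply]
  split_ifs with h1 h2 <;> first | rfl | (exfalso; exact hrc (h1 ▸ h2 ▸ rfl))

/-- Scratch registers are empty. [folklore] -/
structure Clean (T : K → List Bool) : Prop where
  /-- `T1` empty -/ t1 : T .T1 = []
  /-- `Tx` empty -/ tx : T .Tx = []

/-- `Clean` survives writes elsewhere. [folklore] -/
theorem Clean.update {T : K → List Bool} (h : Clean T) {r : K} (hr1 : r ≠ .T1) (hr2 : r ≠ .Tx) (v : List Bool) :
    Clean (Function.update T r v) :=
  ⟨by rw [Function.update_of_ne hr1.symm]; exact h.t1, by rw [Function.update_of_ne hr2.symm]; exact h.tx⟩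

variable {T}

/-- `ldx`. [folklore] -/
theorem runs_ldx (h : Clean T) {r : K} (hr1 : r ≠ .T1) (hr2 : r ≠ .Tx) (y g : List Bool) :
    Runs (ldx r) (S T [] y g) (S T (T r) y g) (10 * (T r).length + 3) := by
  refine (runs_copy (a := o r) (b := Sum.inr AReg.x) (t := o .T1) (u := o .Tx) (by simp) (by simpa using hr1)
    (by simpa using hr2) (by simp) (by simp) (by decide) (S T [] y g) (by simp [h.t1]) (by simp [h.tx])).of_eq ?_ (by simp)
  simp

/-- `ldy`. [folklore] -/
theorem runs_ldy (h : Clean T) {r : K} (hr1 : r ≠ .T1) (hr2 : r ≠ .Tx) (x g : List Bool) :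
    Runs (ldy r) (S T x [] g) (S T x (T r) g) (10 * (T r).length + 3) := by
  refine (runs_copy (a := o r) (b := Sum.inr AReg.y) (t := o .T1) (u := o .Tx) (by simp) (by simpa using hr1)
    (by simpa using hr2) (by simp) (by simp) (by decide) (S T x [] g) (by simp [h.t1]) (by simp [h.tx])).of_eq ?_ (by simp)
  simp

/-- `stx`. [folklore] -/
theorem runs_stx (h : Clean T) {r : K} (hr1 : r ≠ .T1) (hr : T r = []) (x y g : List Bool) :
    Runs (stx r) (S T x y g) (S (Function.update T r x) [] y g) (6 * x.length + 2) := by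
  refine (runs_move (a := Sum.inr AReg.x) (b := o r) (t := o .T1) (by simp) (by simp) (by simpa using hr1)
    (S T x y g) (by simp [h.t1])).of_eq ?_ (by simp)
  simp [hr]

/-- `addR`: `x := x + r`. [folklore] -/
theorem runs_addR (h : Clean T) {r : K} (hr1 : r ≠ .T1) (hr2 : r ≠ .Tx) (x g : List Bool) :
    Runs (addR r) (S T x [] g) (S T (addRes x (T r)) [] g) (25 * (x.length + (T r).length) + 16) := by
  have h1 := runs_ldy h hr1 hr2 x g
  have h2 : Runs (bk add : Com RR) (S T x (T r) g) (S T (addRes x (T r)) (T r) g) (13 * (x.length + (T r).length) + 12) :=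
    (runs_add x (T r) [] [] g).inr T
  have h3 := runs_clear (Sum.inr AReg.y) (S T (addRes x (T r)) (T r) g)
  refine (h1.seq (h2.seq h3)).of_eq (by simp) ?_
  simp; omega

/-- Truncated subtraction as `sub` leaves it: `x − r` if `x ≥ r`, else `x`. [folklore] -/
def subV (x r : List Bool) : List Bool := bif subBorrow x r then x else subRes x r

/-- Value of `subV` when no borrow. [folklore] -/
theorem bitsToNat_subV (x r : List Bool) (hle : bitsToNat r ≤ bitsToNat x) :
    bitsToNat (subV x r) = bitsToNat x - bitsToNat r := by
  rw [subV, subBorrow_iff, decide_eq_false (not_lt.2 hle), cond_false, bitsToNat_subRes _ _ hle]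

/-- Value of `subV` in general. [folklore] -/
theorem bitsToNat_subV' (x r : List Bool) :
    bitsToNat (subV x r) = if bitsToNat r ≤ bitsToNat x then bitsToNat x - bitsToNat r else bitsToNat x := by
  split_ifs with hle
  · exact bitsToNat_subV x r hle
  · rw [subV, subBorrow_iff, decide_eq_true (not_le.1 hle), cond_true]

/-- `subV` keeps the length. [folklore] -/
theorem length_subV (x r : List Bool) : (subV x r).length = x.length := by
  rw [subV]; cases subBorrow x r <;> simp [length_subRes]

/-- `subR`: `x := subV x r`, flag cleared. [folklore] -/
theorem runs_subR (h : Clean T) {r : K} (hr1 : r ≠ .T1) (hr2 : r ≠ .Tx) (x : List Bool) :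
    Runs (subR r) (S T x [] []) (S T (subV x (T r)) [] []) (28 * (x.length + (T r).length) + 20) := by
  have h1 := runs_ldy h hr1 hr2 x []
  have h2 : Runs (bk sub : Com RR) (S T x (T r) []) (S T (subV x (T r)) (T r) (flag !subBorrow x (T r)))
      (16 * (x.length + (T r).length) + 12) := (runs_sub x (T r) []).inr T
  have h3 : Runs (clear (Sum.inr AReg.y) : Com RR) (S T (subV x (T r)) (T r) (flag !subBorrow x (T r)))
      (S T (subV x (T r)) [] (flag !subBorrow x (T r))) (2 * (T r).length + 1) := (runs_clear _ _).of_eq (by simp) (by simp)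
  have h4 : Runs (clear (Sum.inr AReg.g) : Com RR) (S T (subV x (T r)) [] (flag !subBorrow x (T r)))
      (S T (subV x (T r)) [] []) 3 := (runs_clear _ _).of_eq (by simp) (by cases subBorrow x (T r) <;> simp)
  refine (h1.seq (h2.seq (h3.seq h4))).of_eq rfl ?_
  omega

/-- `cmpR`: `g := [x ≥ r]`, `x` cleared. [folklore] -/
theorem runs_cmpR (h : Clean T) {r : K} (hr1 : r ≠ .T1) (hr2 : r ≠ .Tx) (x : List Bool) :
    Runs (cmpR r) (S T x [] []) (S T [] [] (flag (decide (bitsToNat (T r) ≤ bitsToNat x))))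
      (28 * (x.length + (T r).length) + 18) := by
  have h1 := runs_ldy h hr1 hr2 x []
  have h2 : Runs (bk sub : Com RR) (S T x (T r) []) (S T (subV x (T r)) (T r) (flag !subBorrow x (T r)))
      (16 * (x.length + (T r).length) + 12) := (runs_sub x (T r) []).inr T
  have h3 : Runs (clear (Sum.inr AReg.y) : Com RR) (S T (subV x (T r)) (T r) (flag !subBorrow x (T r)))
      (S T (subV x (T r)) [] (flag !subBorrow x (T r))) (2 * (T r).length + 1) := (runs_clear _ _).of_eq (by simp) (by simp)
  have h4 : Runs (clear (Sum.inr AReg.x) : Com RR) (S T (subV x (T r)) [] (flag !subBorrow x (T r)))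
      (S T [] [] (flag !subBorrow x (T r))) (2 * x.length + 1) :=
    (runs_clear _ _).of_eq (by simp) (by simp [length_subV])
  have hf : (!subBorrow x (T r)) = decide (bitsToNat (T r) ≤ bitsToNat x) := by
    rw [subBorrow_iff]
    by_cases hle : bitsToNat (T r) ≤ bitsToNat x
    · simp [hle, not_lt.2 hle]
    · simp [hle, not_le.1 hle]
  refine (h1.seq (h2.seq (h3.seq h4))).of_eq (by rw [hf]) ?_
  omega

/-- `shl`: prepend `|DC|` zeros. [folklore] -/
theorem runs_shl (h : Clean T) {r : K} (hrC : r ≠ .CC) (hCC : T .CC = []) (x y g : List Bool) :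
    Runs (shl r) (S T x y g) (S (Function.update T r (List.replicate (T .DC).length false ++ T r)) x y g)
      (13 * (T .DC).length + 4) := by
  have h1 : Runs (copy (o .DC) (o .CC) (o .T1) (o .Tx) : Com RR) (S T x y g) (S (Function.update T .CC (T .DC)) x y g)
      (10 * (T .DC).length + 3) := by
    refine (runs_copy (a := o .DC) (b := o K.CC) (t := o .T1) (u := o .Tx) (by decide) (by decide) (by decide) (by decide)
      (by decide) (by decide) (S T x y g) (by simp [h.t1]) (by simp [h.tx])).of_eq ?_ (by simp)
    simp [hCC]
  have h2 := runs_indexLoop (c := o K.CC) (body := (push (o r) false : Com RR))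
    (fun i => S (Function.update T r (List.replicate i false ++ T r)) x y g) 1
    (fun i => by simp [Function.update_of_ne (Ne.symm hrC), hCC])
    (T .DC) 0 (fun i _ _ w => by
      refine Runs.push' ?_
      simp only [S, Sum.update_elim_inl, Sum.elim_inl]
      rw [Function.update_of_ne hrC, Function.update_self, upd3 T hrC, List.replicate_succ, List.cons_append])
  simp only [zero_add, List.replicate_zero, List.nil_append, Function.update_eq_self] at h2
  have hstart : Function.update (S T x y g) (o K.CC) (T .DC) = S (Function.update T .CC (T .DC)) x y g := by simp
  rw [hstart] at h2
  refine (h1.seq h2).of_eq rfl (by omega)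

/-- `mkPow`: `r := 2^{|DC| + e}` as a numeral. [folklore] -/
theorem runs_mkPow (h : Clean T) {r : K} (hr1 : r ≠ .T1) (hr2 : r ≠ .Tx) (hrC : r ≠ .CC) (hrD : r ≠ .DC) (hCC : T .CC = [])
    (hr : T r = []) (e : ℕ) (x y g : List Bool) :
    Runs (mkPow r e) (S T x y g) (S (Function.update T r (List.replicate ((T .DC).length + e) false ++ [true])) x y g)
      (13 * (T .DC).length + e + 5) := by
  have h1 : Runs (push (o r) true : Com RR) (S T x y g) (S (Function.update T r [true]) x y g) 1 := Runs.push' (by simp [hr])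
  have h2 : Runs (pushN (o r) false e : Com RR) (S (Function.update T r [true]) x y g)
      (S (Function.update T r (List.replicate e false ++ [true])) x y g) e :=
    (runs_pushN (o r) false e _).of_eq (by simp) le_rfl
  have h3 := runs_shl (h.update hr1 hr2 _) hrC (by simp [hrC.symm, hCC]) (T := Function.update T r (List.replicate e false ++ [true])) x y g
  refine (h1.seq (h2.seq h3)).of_eq ?_ ?_
  · simp only [Function.update_idem, Function.update_self, Function.update_of_ne (Ne.symm hrD), ← List.append_assoc,
      List.replicate_append_replicate]
  · simp [Function.update_of_ne (Ne.symm hrD)]; omega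

end Macros

/-! ### The level numerator, the modular distance, one refinement step -/

section Step

attribute [-simp] Sum.elim_update_left Sum.elim_update_right

variable {T : K → List Bool}

/-- **`mkK` reads the level numerator**: with `KS = ks` and `V = []` it leaves
`V = encodeNat (kq c s)` for `s = ks[0]`, `c = ks[1]` (missing bits `0`) and drops the two bits.
[cite: Kitaev1995, §3 (before Lemma 9)] -/
theorem runs_mkK (hV : T .V = []) (ks x y g : List Bool) (hKS : T .KS = ks) :
    Runs mkK (S T x y g) (S (Function.update (Function.update T .KS (ks.drop 2)) .V
      (encodeNat (kq (ks.getD 1 false) (ks.getD 0 false)))) x y g) 7 := by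
  have e1 : encodeNat 1 = [true] := by decide
  have e3 : encodeNat 3 = [true, true] := by decide
  have e5 : encodeNat 5 = [true, false, true] := by decide
  have e7 : encodeNat 7 = [true, true, true] := by decide
  -- the inner programs on a file whose `KS` is `ks'`
  have inner_t : ∀ (T' : K → List Bool), T' .V = [] → ∀ ks' : List Bool, T' .KS = ks' →
      Runs (pop (o .KS) (push (o .V) true) (push (o .V) true ;; push (o .V) true) (push (o .V) true ;; push (o .V) true) : Com RR)
        (S T' x y g) (S (Function.update (Function.update T' .KS (ks'.drop 1)) .V (encodeNat (kq (ks'.getD 0 false) true))) x y g) 4 := by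
    intro T' hV' ks' hKS'
    rcases ks' with _ | ⟨c, rest⟩
    · refine (Runs.pop_nil _ _ (by simp [hKS']) ((Runs.push' rfl).seq (Runs.push' rfl))).of_eq ?_ (by omega)
      rw [List.drop_nil, show Function.update T' K.KS ([] : List Bool) = T' from Function.update_eq_self_iff.2 hKS'.symm]
      simp [kq, e3, hV']
    · cases c
      · refine (Runs.pop_false _ _ (w := rest) (by simp [hKS']) ((Runs.push' rfl).seq (Runs.push' rfl))).of_eq ?_ (by omega)
        simp [kq, e3, hV']
      · refine (Runs.pop_true _ _ (w := rest) (by simp [hKS']) (Runs.push' rfl)).of_eq ?_ (by omega)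
        simp [kq, e1, hV']
  have inner_f : ∀ (T' : K → List Bool), T' .V = [] → ∀ ks' : List Bool, T' .KS = ks' →
      Runs (pop (o .KS) (pushN (o .V) true 3) (push (o .V) true ;; (push (o .V) false ;; push (o .V) true))
        (push (o .V) true ;; (push (o .V) false ;; push (o .V) true)) : Com RR)
        (S T' x y g) (S (Function.update (Function.update T' .KS (ks'.drop 1)) .V (encodeNat (kq (ks'.getD 0 false) false))) x y g) 5 := by
    intro T' hV' ks' hKS'
    rcases ks' with _ | ⟨c, rest⟩
    · refine (Runs.pop_nil _ _ (by simp [hKS']) ((Runs.push' rfl).seq ((Runs.push' rfl).seq (Runs.push' rfl)))).of_eq ?_ (by omega)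
      rw [List.drop_nil, show Function.update T' K.KS ([] : List Bool) = T' from Function.update_eq_self_iff.2 hKS'.symm]
      simp [kq, e5, hV']
    · cases c
      · refine (Runs.pop_false _ _ (w := rest) (by simp [hKS'])
          ((Runs.push' rfl).seq ((Runs.push' rfl).seq (Runs.push' rfl)))).of_eq ?_ (by omega)
        simp [kq, e5, hV']
      · refine (Runs.pop_true _ _ (w := rest) (by simp [hKS']) ((runs_pushN (o K.V) true 3 _).of_eq rfl le_rfl)).of_eq ?_ (by omega)
        simp [kq, e7, hV']
  rcases ks with _ | ⟨sb, ks1⟩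
  · refine (Runs.pop_nil _ _ (by simp [hKS]) (inner_f T hV [] hKS)).of_eq ?_ (by omega)
    simp
  · have hk : (S T x y g) (o .KS) = sb :: ks1 := by simp [hKS]
    cases sb
    · have := inner_f (Function.update T .KS ks1) (by simp [hV]) ks1 (by simp)
      simp only [Function.update_idem] at this
      exact (Runs.pop_false _ _ hk (by simpa using this)).of_eq rfl (by omega)
    · have := inner_t (Function.update T .KS ks1) (by simp [hV]) ks1 (by simp)
      simp only [Function.update_idem] at this
      exact (Runs.pop_true _ _ hk (by simpa using this)).of_eq rfl (by omega)

/-- The numeral of `2^n`. [folklore] -/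
def pw (n : ℕ) : List Bool := List.replicate n false ++ [true]

/-- Value of `pw`. [folklore] -/
@[simp] theorem bitsToNat_pw (n : ℕ) : bitsToNat (pw n) = 2 ^ n := by
  simp [pw, bitsToNat_append, bitsToNat_replicate_false]

/-- Length of `pw`. [folklore] -/
@[simp] theorem length_pw (n : ℕ) : (pw n).length = n + 1 := by simp [pw]

/-- The modular distance computed by `distC` from `x₀`: reduce `x₀ + N − v` below `N = 2^{d+4}`,
then `N − w` if `w ≥ N/2`, else `w`. [cite: Kitaev1995, §3 Lemma 10] -/
def mdist (d v x₀ : ℕ) : ℕ :=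
  let w := (x₀ + 2 ^ (d + 4) - v) % 2 ^ (d + 4)
  if 2 ^ (d + 3) ≤ w then 2 ^ (d + 4) - w else w

/-- `mdist` is the modular distance `md`. [folklore] -/
theorem mdist_eq (d v x₀ : ℕ) :
    mdist d v x₀ = md ((x₀ + 2 ^ (d + 4) - v) % 2 ^ (d + 4)) (2 ^ (d + 4)) := by
  simp only [mdist, md]
  have hw : (x₀ + 2 ^ (d + 4) - v) % 2 ^ (d + 4) < 2 ^ (d + 4) := Nat.mod_lt _ (by positivity)
  have h2 : 2 ^ (d + 4) = 2 * 2 ^ (d + 3) := by rw [pow_succ]; ring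
  split_ifs with h
  · rw [min_eq_right (by omega)]
  · rw [min_eq_left (by omega)]

/-- Hypotheses on the own registers during a refinement step at depth `d` with `v` loaded.
[folklore] -/
structure StepRegs (T : K → List Bool) (d v : ℕ) : Prop where
  /-- scratch clean -/ clean : Clean T
  /-- `NB = 2^{d+4}` -/ nb : T .NB = pw (d + 4)
  /-- `HF = 2^{d+3}` -/ hf : T .HF = pw (d + 3)
  /-- value of `V` -/ v_val : bitsToNat (T .V) = v
  /-- length of `V` -/ v_len : (T .V).length ≤ d + 4
  /-- `v < N` -/ v_lt : v < 2 ^ (d + 4)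
  /-- `W1` empty -/ w1 : T .W1 = []

/-- The cost of `distC` at depth `d`. [folklore] -/
def distCost (d : ℕ) : ℕ := 310 * d + 1800

/-- Clearing a register that was written and is reset. [folklore] -/
theorem update_update_eq_of_eq (T : K → List Bool) {a b : K} (hab : a ≠ b) (u v : List Bool) (ha : T a = []) :
    Function.update (Function.update (Function.update T a u) b v) a [] = Function.update T b v := by
  rw [upd3 T hab, show Function.update T a ([] : List Bool) = T from Function.update_eq_self_iff.2 ha.symm]

/-- **Simulation of `distC m`**: from `x = x₀ < N` it stores a numeral of `mdist d v x₀` in the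
empty register `m`, everything else restored. [cite: Kitaev1995, §3 Lemma 10] -/
theorem runs_distC {d v : ℕ} (hT : StepRegs T d v) {m : K} (hm1 : m ≠ .T1) (hmW : m ≠ .W1) (hm : T m = [])
    (x : List Bool) (x₀ : ℕ) (hx : bitsToNat x = x₀) (hx₀ : x₀ < 2 ^ (d + 4)) (hxl : x.length ≤ d + 5) :
    ∃ ml : List Bool, bitsToNat ml = mdist d v x₀ ∧ ml.length ≤ d + 6 ∧
      Runs (distC m) (S T x [] []) (S (Function.update T m ml) [] [] []) (distCost d) := by
  have hc := hT.clean
  set N := 2 ^ (d + 4) with hN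
  set H := 2 ^ (d + 3) with hH
  have hNH : N = 2 * H := by rw [hN, hH, pow_succ]; ring
  -- 1. x := x + N
  have h1 := runs_addR hc (r := .NB) (by decide) (by decide) x []
  set x1 := addRes x (T .NB) with hx1
  have hx1v : bitsToNat x1 = x₀ + N := by rw [hx1, bitsToNat_addRes, hx, hT.nb, bitsToNat_pw]
  have hx1l : x1.length ≤ d + 6 := by
    have := length_addRes_le_max x (T .NB)
    rw [hT.nb, length_pw] at this
    rw [hx1, hT.nb]; refine this.trans ?_
    rcases le_total x.length (d + 4 + 1) with h | h
    · rw [max_eq_right h]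
    · rw [max_eq_left h]; omega
  -- 2. x := x - v
  have h2 := runs_subR hc (r := .V) (by decide) (by decide) x1
  set x2 := subV x1 (T .V) with hx2
  have hx2v : bitsToNat x2 = x₀ + N - v := by
    rw [hx2, bitsToNat_subV _ _ (by rw [hT.v_val, hx1v]; have := hT.v_lt; omega), hx1v, hT.v_val]
  have hx2l : x2.length ≤ d + 6 := by rw [hx2, length_subV]; exact hx1l
  -- 3. reduce below N
  have h3 := runs_subR hc (r := .NB) (by decide) (by decide) x2
  set x3 := subV x2 (T .NB) with hx3
  have hx3v : bitsToNat x3 = (x₀ + N - v) % N := by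
    rw [hx3, bitsToNat_subV', hT.nb, bitsToNat_pw, hx2v]
    have hvN := hT.v_lt
    split_ifs with hle
    · rw [Nat.mod_eq_sub_mod hle, Nat.mod_eq_of_lt (by omega)]
    · rw [Nat.mod_eq_of_lt (by omega)]
  have hx3l : x3.length ≤ d + 6 := by rw [hx3, length_subV]; exact hx2l
  have hx3N : bitsToNat x3 < N := by rw [hx3v]; exact Nat.mod_lt _ (by positivity)
  -- 4. W1 := w; 5. x := w
  have h4 := runs_stx hc (r := .W1) (by decide) hT.w1 x3 [] []
  set T1 := Function.update T .W1 x3 with hT1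
  have hc1 : Clean T1 := hc.update (by decide) (by decide) _
  have h5 := runs_ldx hc1 (r := .W1) (by decide) (by decide) [] []
  have hT1W : T1 .W1 = x3 := by simp [hT1]
  rw [hT1W] at h5
  -- 6. compare with H
  have h6 := runs_cmpR hc1 (r := .HF) (by decide) (by decide) x3
  have hT1H : T1 .HF = pw (d + 3) := by simp [hT1, hT.hf]
  rw [hT1H, bitsToNat_pw, length_pw] at h6
  -- 7. the branch
  have hfin : ∀ ml : List Bool, Function.update (Function.update T1 m ml) .W1 [] = Function.update T m ml := fun ml => by
    rw [hT1]; exact update_update_eq_of_eq T (Ne.symm hmW) _ _ hT.w1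
  by_cases hle : H ≤ bitsToNat x3
  · -- N - w
    set x4 := subV (T .NB) x3 with hx4
    have hx4v : bitsToNat x4 = N - bitsToNat x3 := by
      rw [hx4, bitsToNat_subV _ _ (by rw [hT.nb, bitsToNat_pw]; omega), hT.nb, bitsToNat_pw]
    have hx4l : x4.length ≤ d + 6 := by rw [hx4, length_subV, hT.nb, length_pw]; omega
    refine ⟨x4, ?_, hx4l, ?_⟩
    · rw [hx4v, mdist, hx3v]; simp only [← hN, ← hH]; rw [if_pos (hx3v ▸ hle)]
    have h7a := runs_ldx hc1 (r := .NB) (by decide) (by decide) [] []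
    have hT1N : T1 .NB = T .NB := by simp [hT1]
    rw [hT1N] at h7a
    have h7b := runs_subR hc1 (r := .W1) (by decide) (by decide) (T .NB)
    rw [hT1W, ← hx4] at h7b
    have h7c := runs_stx hc1 (r := m) hm1 (by rw [hT1, Function.update_of_ne hmW, hm]) x4 [] []
    have h7d : Runs (clear (o .W1) : Com RR) (S (Function.update T1 m x4) [] [] []) (S (Function.update T m x4) [] [] [])
        (2 * x3.length + 1) := by
      refine (runs_clear (o .W1) _).of_eq ?_ ?_
      · simp only [S, Sum.update_elim_inl, hfin]
      · simp [Function.update_of_ne (Ne.symm hmW), hT1W]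
    have hbr := h7a.seq (h7b.seq (h7c.seq h7d))
    have h7 : Runs (pop (Sum.inr .g) (ldx .NB ;; (subR .W1 ;; (stx m ;; clear (o .W1)))) skip (move (o .W1) (o m) (o .T1)) : Com RR)
        (S T1 [] [] (flag (decide (2 ^ (d + 3) ≤ bitsToNat x3)))) (S (Function.update T m x4) [] [] []) _ :=
      Runs.pop_true _ _ (w := []) (by simp [← hH, decide_eq_true hle]) (by simpa using hbr)
    refine (h1.seq (h2.seq (h3.seq (h4.seq (h5.seq (h6.seq h7)))))).of_eq rfl ?_
    have := hT.v_len
    rw [distCost, hT.nb, length_pw]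
    omega
  · -- w itself
    refine ⟨x3, ?_, hx3l, ?_⟩
    · rw [mdist, hx3v]; simp only [← hN, ← hH]; rw [if_neg (hx3v ▸ hle)]
    have h7m : Runs (move (o .W1) (o m) (o .T1) : Com RR) (S T1 [] [] []) (S (Function.update T m x3) [] [] []) (6 * x3.length + 2) := by
      refine (runs_move (a := o .W1) (b := o m) (t := o .T1) (by simpa using Ne.symm hmW) (by decide) (by simpa using hm1)
        (S T1 [] [] []) (by simp [hc1.t1])).of_eq ?_ (by simp [hT1W])
      simp only [S, Sum.update_elim_inl, Sum.elim_inl, hT1W]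
      rw [show T1 m = [] by rw [hT1, Function.update_of_ne hmW, hm], List.append_nil, hT1, Function.update_idem,
        show Function.update T K.W1 ([] : List Bool) = T from Function.update_eq_self_iff.2 hT.w1.symm]
    have h7 : Runs (pop (Sum.inr .g) (ldx .NB ;; (subR .W1 ;; (stx m ;; clear (o .W1)))) skip (move (o .W1) (o m) (o .T1)) : Com RR)
        (S T1 [] [] (flag (decide (2 ^ (d + 3) ≤ bitsToNat x3)))) (S (Function.update T m x3) [] [] []) _ :=
      Runs.pop_nil _ _ (by simp [← hH, decide_eq_false hle]) (by simpa [← hH, decide_eq_false hle] using h7m)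
    refine (h1.seq (h2.seq (h3.seq (h4.seq (h5.seq (h6.seq h7)))))).of_eq rfl ?_
    have := hT.v_len
    rw [distCost, hT.nb, length_pw]
    omega

/-- The value of one refinement step from `a` at depth `d + 1` with level numerator `k`.
[cite: Kitaev1995, §3 Lemma 10] -/
def stepVal (a d k : ℕ) : ℕ :=
  if mdist d (k * 2 ^ (d + 1)) a ≤ mdist d (k * 2 ^ (d + 1)) (a + 2 ^ (d + 3)) then a else a + 2 ^ (d + 3)

/-- **The step value is the step of `refineNat`.** [cite: Kitaev1995, §3 Lemma 10] -/
theorem refineNat_succ (κ : ℕ → ℕ) (L d : ℕ) :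
    refineNat κ L (d + 1) = stepVal (refineNat κ L d) d (κ (L - 1 - (d + 1))) := by
  rw [refineNat, stepVal, mdist_eq, mdist_eq]
  have hN : 8 * 2 ^ (d + 1) = 2 ^ (d + 4) := by rw [pow_add, pow_add]; norm_num; ring
  have hH : 2 ^ (d + 4) / 2 = 2 ^ (d + 3) := by rw [pow_succ]; omega
  simp only [hN, hH]

/-- The step value stays below `2^{d+4}`. [folklore] -/
theorem stepVal_lt {a : ℕ} (d k : ℕ) (ha : a < 2 ^ (d + 3)) : stepVal a d k < 2 ^ (d + 4) := by
  rw [stepVal]; have : 2 ^ (d + 4) = 2 * 2 ^ (d + 3) := by rw [pow_succ]; ring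
  split_ifs <;> omega

/-- `|encodeNat n| ≤ k` when `n < 2^k`. Refactor: twin of `Literature.Computability.Cryptography.length_encodeNat_le_of_lt`
(`ShorClassicalOracle.lean`) and `Literature.Computability.Complexity.length_encodeNat_le_of_lt` (`StackWordArith.lean`),
neither in the import closure of this file; re-proved in one line to keep the closure small. [folklore] -/
theorem length_encodeNat_le_of_lt {n k : ℕ} (h : n < 2 ^ k) : (encodeNat n).length ≤ k := by
  rw [← norm_encodeNat, length_norm, bitsToNat_encodeNat]; exact Nat.size_le.2 h

/-- The cost of the branch at depth `d`. [folklore] -/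
def branchCost (d : ℕ) : ℕ := 77 * d + 320

/-- **Simulation of `branchC`**: on flag `b`, `AA := encodeNat a` is kept (`b = true`) or becomes
`encodeNat (a + 2^{d+3})`. [cite: Kitaev1995, §3 Lemma 10] -/
theorem runs_branchC (hc : Clean T) {a d : ℕ} (hAA : T .AA = encodeNat a) (hHF : T .HF = pw (d + 3))
    (ha : a < 2 ^ (d + 3)) (b : Bool) :
    Runs branchC (S T [] [] (flag b))
      (S (Function.update T .AA (encodeNat (bif b then a else a + 2 ^ (d + 3)))) [] [] []) (branchCost d) := by
  have hal : (encodeNat a).length ≤ d + 3 := length_encodeNat_le_of_lt ha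
  cases b
  · set xb := addRes (encodeNat a) (pw (d + 3)) with hxb
    have hxbv : bitsToNat xb = a + 2 ^ (d + 3) := by rw [hxb, bitsToNat_addRes, bitsToNat_encodeNat, bitsToNat_pw]
    have hxbl : xb.length ≤ d + 5 := by
      have := length_addRes_le_max (encodeNat a) (pw (d + 3))
      rw [length_pw, max_eq_right (by omega)] at this
      rw [hxb]; omega
    have i1 := runs_ldx hc (r := .AA) (by decide) (by decide) [] []
    rw [hAA] at i1
    have i2 := runs_addR hc (r := .HF) (by decide) (by decide) (encodeNat a) []
    rw [hHF, ← hxb] at i2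
    have i3 : Runs (clear (o .AA) : Com RR) (S T xb [] []) (S (Function.update T .AA []) xb [] []) (2 * (d + 3) + 1) :=
      (runs_clear (o .AA) _).of_eq (by simp) (by simp [hAA]; omega)
    have i4 : Runs (bk normalize : Com RR) (S (Function.update T .AA []) xb [] [])
        (S (Function.update T .AA []) (encodeNat (a + 2 ^ (d + 3))) [] []) (9 * xb.length + 5) := by
      refine ((runs_normalize xb [] [] [] [] []).inr _).of_eq ?_ le_rfl
      simp only [S, norm_eq_encodeNat, hxbv]
    have i5 := runs_stx (hc.update (by decide) (by decide) _) (r := .AA) (by decide) (by simp) (encodeNat (a + 2 ^ (d + 3))) [] []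
      (T := Function.update T .AA [])
    rw [Function.update_idem] at i5
    have hal' : (encodeNat (a + 2 ^ (d + 3))).length ≤ d + 4 :=
      length_encodeNat_le_of_lt (by have : 2 ^ (d + 4) = 2 * 2 ^ (d + 3) := by rw [pow_succ]; ring
                                    omega)
    refine (Runs.pop_nil _ _ (by simp) (i1.seq (i2.seq (i3.seq (i4.seq i5))))).of_eq (by simp) ?_
    rw [branchCost, length_pw]; omega
  · refine (Runs.pop_true _ _ (w := []) (by simp [flag]) (Runs.skip _)).of_eq ?_ (by rw [branchCost]; omega)
    rw [show Function.update T K.AA (encodeNat (bif true then a else a + 2 ^ (d + 3))) = T from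
      Function.update_eq_self_iff.2 (by simpa using hAA.symm)]
    simp [S, flag]

end Step

/-! ### Simulation of the parser -/

section Parse

attribute [-simp] Sum.elim_update_left Sum.elim_update_right

/-- The first input component (the numeral `N`). [folklore] -/
def pN (z : List Bool) : List Bool := (boolUnpair z).1
/-- The second input component `⟨U, κ-bits⟩`. [folklore] -/
def pW (z : List Bool) : List Bool := (boolUnpair z).2
/-- The unary length component `U`. [folklore] -/
def pU (z : List Bool) : List Bool := (boolUnpair (pW z)).1
/-- The test bits. [folklore] -/
def pK (z : List Bool) : List Bool := (boolUnpair (pW z)).2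
/-- The instance length `ℓ = |U|`. [folklore] -/
def ell (z : List Bool) : ℕ := (pU z).length

/-- An emitted component on the output stack: `⟨v, ·⟩` pushed bit by bit. [folklore] -/
def emitted (v rest : List Bool) : List Bool := true :: false :: ((v.flatMap fun b => [b, b]).reverse ++ rest)

/-! The successive register files of `parse` (association lists, newest writes first). -/

/-- Stage 0. [folklore] -/
def st0 (z : List Bool) : List (K × List Bool) := [(.inp, z)]
/-- Stage 1. [folklore] -/
def st1 (z : List Bool) : List (K × List Bool) :=
  (.P1, []) :: (.M1, flag (wellPaired z)) :: (.T, (pW z).reverse) :: (.A, (pN z).reverse) :: (.inp, []) :: st0 z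
/-- Stage 2. [folklore] -/
def st2 (z : List Bool) : List (K × List Bool) := (.NN, pN z) :: (.A, []) :: st1 z
/-- Stage 3. [folklore] -/
def st3 (z : List Bool) : List (K × List Bool) := (.W, pW z) :: (.T, []) :: st2 z
/-- Stage 4. [folklore] -/
def st4 (z : List Bool) : List (K × List Bool) :=
  (.P2, []) :: (.M2, flag (wellPaired (pW z))) :: (.T2, (pK z).reverse) :: (.A2, (pU z).reverse) :: (.W, []) :: st3 z
/-- Stage 5. [folklore] -/
def st5 (z : List Bool) : List (K × List Bool) := (.L, ones (ell z)) :: (.A2, ones (ell z)) :: st4 z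
/-- Stage 6. [folklore] -/
def st6 (z : List Bool) : List (K × List Bool) := (.A2, []) :: st5 z
/-- Stage 7. [folklore] -/
def st7 (z : List Bool) : List (K × List Bool) := (.KP, pK z) :: (.T2, []) :: st6 z
/-- Stage 8. [folklore] -/
def st8 (z : List Bool) : List (K × List Bool) := (.LV, ones (ell z)) :: (.L, ones (ell z)) :: st7 z
/-- Stage 9. [folklore] -/
def st9 (z : List Bool) : List (K × List Bool) := (.LV, ones (ell z + ell z)) :: (.L, ones (ell z)) :: st8 z
/-- Stage 10. [folklore] -/
def st10 (z : List Bool) : List (K × List Bool) := (.OUT, emitted (pN z) []) :: (.NN, []) :: st9 z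
/-- Stage 11. [folklore] -/
def st11 (z : List Bool) : List (K × List Bool) := (.LC, ones (ell z)) :: st10 z
/-- Stage 12: the register file after `parse`. [folklore] -/
def parsed (z : List Bool) : List (K × List Bool) := (.OUT, emitted (ones (ell z)) (emitted (pN z) [])) :: (.LC, []) :: st11 z

attribute [local simp] st0 st1 st2 st3 st4 st5 st6 st7 st8 st9 st10 st11 parsed update_fileOf fileOf_cons

/-- The cost of the parser. [folklore] -/
def parseCost (s : ℕ) : ℕ := 64 * s + 40

/-- The own-register file embedded with a clean bank. [folklore] -/
theorem S_fileOf_eq (l : List (K × List Bool)) : S (fileOf l) [] [] [] = Sum.elim (fileOf l) (file [] [] [] [] [] [] [] []) := rfl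

/-- **Simulation of `parse`.** [folklore] -/
theorem runs_parse (z : List Bool) : Runs parse (S (fileOf (st0 z)) [] [] []) (S (fileOf (parsed z)) [] [] []) (parseCost z.length) := by
  have hN : (pN z).length ≤ z.length := length_boolUnpair_fst_le z
  have hW : (pW z).length ≤ z.length := length_boolUnpair_snd_le z
  have hU : (pU z).length ≤ (pW z).length := length_boolUnpair_fst_le _
  have hK : (pK z).length ≤ (pW z).length := length_boolUnpair_snd_le _
  have hℓ : ell z = (pU z).length := rfl
  have h1 : Runs _ (S (fileOf (st0 z)) [] [] []) (S (fileOf (st1 z)) [] [] []) _ :=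
    (runs_unpairW (k := o .inp) (a := o .A) (t := o .T) (M := o .M1) (P := o .P1) (by decide) (S (fileOf (st0 z)) [] [] [])
      rfl rfl).of_eq (by simp [S, pW, pN]) le_rfl
  have h2 : Runs _ (S (fileOf (st1 z)) [] [] []) (S (fileOf (st2 z)) [] [] []) _ :=
    (runs_pour (a := o .A) (b := o .NN) (by decide) (S (fileOf (st1 z)) [] [] [])).of_eq (by simp [S]) le_rfl
  have h3 : Runs _ (S (fileOf (st2 z)) [] [] []) (S (fileOf (st3 z)) [] [] []) _ :=
    (runs_pour (a := o .T) (b := o .W) (by decide) (S (fileOf (st2 z)) [] [] [])).of_eq (by simp [S]) le_rfl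
  have h4 : Runs _ (S (fileOf (st3 z)) [] [] []) (S (fileOf (st4 z)) [] [] []) _ :=
    (runs_unpairW (k := o .W) (a := o .A2) (t := o .T2) (M := o .M2) (P := o .P2) (by decide) (S (fileOf (st3 z)) [] [] [])
      rfl rfl).of_eq (by simp [S, pU, pK]) le_rfl
  have h5 : Runs _ (S (fileOf (st4 z)) [] [] []) (S (fileOf (st5 z)) [] [] []) _ :=
    (runs_addReg (p := o .A2) (v := o .L) (t := o .T1) (by decide) (by decide) (by decide) (S (fileOf (st4 z)) [] [] [])
      rfl).of_eq (by simp [S, ell]) le_rfl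
  have h6 : Runs _ (S (fileOf (st5 z)) [] [] []) (S (fileOf (st6 z)) [] [] []) _ :=
    (runs_clear (o .A2) (S (fileOf (st5 z)) [] [] [])).of_eq (by simp [S]) le_rfl
  have h7 : Runs _ (S (fileOf (st6 z)) [] [] []) (S (fileOf (st7 z)) [] [] []) _ :=
    (runs_pour (a := o .T2) (b := o .KP) (by decide) (S (fileOf (st6 z)) [] [] [])).of_eq (by simp [S]) le_rfl
  have h8 : Runs _ (S (fileOf (st7 z)) [] [] []) (S (fileOf (st8 z)) [] [] []) _ :=
    (runs_addReg (p := o .L) (v := o .LV) (t := o .T1) (by decide) (by decide) (by decide) (S (fileOf (st7 z)) [] [] [])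
      rfl).of_eq (by simp [S, ones]) le_rfl
  have h9 : Runs _ (S (fileOf (st8 z)) [] [] []) (S (fileOf (st9 z)) [] [] []) _ :=
    (runs_addReg (p := o .L) (v := o .LV) (t := o .T1) (by decide) (by decide) (by decide) (S (fileOf (st8 z)) [] [] [])
      rfl).of_eq (by simp [S, ones]) le_rfl
  have h10 : Runs _ (S (fileOf (st9 z)) [] [] []) (S (fileOf (st10 z)) [] [] []) _ :=
    (runs_emit (h := o .NN) (o := o .OUT) (by decide) (S (fileOf (st9 z)) [] [] [])).of_eq (by simp [S, emitted]) le_rfl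
  have h11 : Runs _ (S (fileOf (st10 z)) [] [] []) (S (fileOf (st11 z)) [] [] []) _ :=
    (runs_copy (a := o .L) (b := o .LC) (t := o .T1) (u := o .Tx) (by decide) (by decide) (by decide) (by decide) (by decide)
      (by decide) (S (fileOf (st10 z)) [] [] []) rfl rfl).of_eq (by simp [S]) le_rfl
  have h12 : Runs _ (S (fileOf (st11 z)) [] [] []) (S (fileOf (parsed z)) [] [] []) _ :=
    (runs_emit (h := o .LC) (o := o .OUT) (by decide) (S (fileOf (st11 z)) [] [] [])).of_eq (by simp [S, emitted]) le_rfl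
  refine (h1.seq (h2.seq (h3.seq (h4.seq (h5.seq (h6.seq (h7.seq (h8.seq (h9.seq (h10.seq (h11.seq h12))))))))))).of_eq rfl ?_
  simp [S, ell, parseCost]
  omega

end Parse

/-! ### The kernel's register file -/

/-- The changing own registers during the trials. [folklore] -/
structure KSt where
  /-- unread test bits -/ KP : List Bool
  /-- test bits of the current trial, reversed -/ KS : List Bool
  /-- the estimate `a` -/ AA : List Bool
  /-- depth counter `1^{d+1}` -/ DC : List Bool
  /-- level counter -/ LC : List Bool
  /-- `v = κ 2^{d+1}` -/ V : List Bool
  /-- `N = 2^{d+4}` -/ NB : List Bool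
  /-- `N/2` -/ HF : List Bool
  /-- scratch of `distC` -/ W1 : List Bool
  /-- first distance -/ MA : List Bool
  /-- second distance -/ MB : List Bool
  /-- shift counter -/ CC : List Bool
  /-- output stack -/ OUT : List Bool

/-- The own-register file of a kernel state over the parsed file. [folklore] -/
def kf (z : List Bool) (st : KSt) : K → List Bool
  | .KP => st.KP | .KS => st.KS | .AA => st.AA | .DC => st.DC | .LC => st.LC | .V => st.V | .NB => st.NB
  | .HF => st.HF | .W1 => st.W1 | .MA => st.MA | .MB => st.MB | .CC => st.CC | .OUT => st.OUT
  | k => fileOf (parsed z) k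

section KFile

attribute [local simp] st0 st1 st2 st3 st4 st5 st6 st7 st8 st9 st10 st11 parsed update_fileOf fileOf_cons

variable (z : List Bool) (st : KSt) (v : List Bool)

/-- Reading `KP`. [folklore] -/ @[simp] theorem kf_KP : kf z st .KP = st.KP := rfl
/-- Reading `KS`. [folklore] -/ @[simp] theorem kf_KS : kf z st .KS = st.KS := rfl
/-- Reading `AA`. [folklore] -/ @[simp] theorem kf_AA : kf z st .AA = st.AA := rfl
/-- Reading `DC`. [folklore] -/ @[simp] theorem kf_DC : kf z st .DC = st.DC := rfl
/-- Reading `LC`. [folklore] -/ @[simp] theorem kf_LC : kf z st .LC = st.LC := rfl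
/-- Reading `V`. [folklore] -/ @[simp] theorem kf_V : kf z st .V = st.V := rfl
/-- Reading `NB`. [folklore] -/ @[simp] theorem kf_NB : kf z st .NB = st.NB := rfl
/-- Reading `HF`. [folklore] -/ @[simp] theorem kf_HF : kf z st .HF = st.HF := rfl
/-- Reading `W1`. [folklore] -/ @[simp] theorem kf_W1 : kf z st .W1 = st.W1 := rfl
/-- Reading `MA`. [folklore] -/ @[simp] theorem kf_MA : kf z st .MA = st.MA := rfl
/-- Reading `MB`. [folklore] -/ @[simp] theorem kf_MB : kf z st .MB = st.MB := rfl
/-- Reading `CC`. [folklore] -/ @[simp] theorem kf_CC : kf z st .CC = st.CC := rfl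
/-- Reading `OUT`. [folklore] -/ @[simp] theorem kf_OUT : kf z st .OUT = st.OUT := rfl
/-- Reading `T1`. [folklore] -/ @[simp] theorem kf_T1 : kf z st .T1 = [] := by simp [kf, parsed, fileOf_cons]
/-- Reading `Tx`. [folklore] -/ @[simp] theorem kf_Tx : kf z st .Tx = [] := by simp [kf, parsed, fileOf_cons]
/-- Reading `RES`. [folklore] -/ @[simp] theorem kf_RES : kf z st .RES = [] := by simp [kf, parsed, fileOf_cons]
/-- Reading `LV`. [folklore] -/
@[simp] theorem kf_LV : kf z st .LV = ones (ell z + ell z) := by simp [kf, parsed, fileOf_cons]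

/-- Writing `KP`. [folklore] -/
@[simp] theorem update_kf_KP : Function.update (kf z st) .KP v = kf z { st with KP := v } := by
  funext k; cases k <;> simp [kf]
/-- Writing `KS`. [folklore] -/
@[simp] theorem update_kf_KS : Function.update (kf z st) .KS v = kf z { st with KS := v } := by
  funext k; cases k <;> simp [kf]
/-- Writing `AA`. [folklore] -/
@[simp] theorem update_kf_AA : Function.update (kf z st) .AA v = kf z { st with AA := v } := by
  funext k; cases k <;> simp [kf]
/-- Writing `DC`. [folklore] -/
@[simp] theorem update_kf_DC : Function.update (kf z st) .DC v = kf z { st with DC := v } := by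
  funext k; cases k <;> simp [kf]
/-- Writing `LC`. [folklore] -/
@[simp] theorem update_kf_LC : Function.update (kf z st) .LC v = kf z { st with LC := v } := by
  funext k; cases k <;> simp [kf]
/-- Writing `V`. [folklore] -/
@[simp] theorem update_kf_V : Function.update (kf z st) .V v = kf z { st with V := v } := by
  funext k; cases k <;> simp [kf]
/-- Writing `NB`. [folklore] -/
@[simp] theorem update_kf_NB : Function.update (kf z st) .NB v = kf z { st with NB := v } := by
  funext k; cases k <;> simp [kf]
/-- Writing `HF`. [folklore] -/
@[simp] theorem update_kf_HF : Function.update (kf z st) .HF v = kf z { st with HF := v } := by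
  funext k; cases k <;> simp [kf]
/-- Writing `W1`. [folklore] -/
@[simp] theorem update_kf_W1 : Function.update (kf z st) .W1 v = kf z { st with W1 := v } := by
  funext k; cases k <;> simp [kf]
/-- Writing `MA`. [folklore] -/
@[simp] theorem update_kf_MA : Function.update (kf z st) .MA v = kf z { st with MA := v } := by
  funext k; cases k <;> simp [kf]
/-- Writing `MB`. [folklore] -/
@[simp] theorem update_kf_MB : Function.update (kf z st) .MB v = kf z { st with MB := v } := by
  funext k; cases k <;> simp [kf]
/-- Writing `CC`. [folklore] -/
@[simp] theorem update_kf_CC : Function.update (kf z st) .CC v = kf z { st with CC := v } := by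
  funext k; cases k <;> simp [kf]
/-- Writing `OUT`. [folklore] -/
@[simp] theorem update_kf_OUT : Function.update (kf z st) .OUT v = kf z { st with OUT := v } := by
  funext k; cases k <;> simp [kf]

/-- The scratch registers of a kernel file are clean. [folklore] -/
theorem clean_kf : Clean (kf z st) := ⟨kf_T1 z st, kf_Tx z st⟩

end KFile

/-- The parsed file is the kernel file of the initial state. [folklore] -/
theorem parsed_eq_kf (z : List Bool) :
    fileOf (parsed z) = kf z ⟨pK z, [], [], [], [], [], [], [], [], [], [], [], emitted (ones (ell z)) (emitted (pN z) [])⟩ := by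
  funext k
  cases k <;> simp [kf, parsed, st11, st10, st9, st8, st7, st6, st5, st4, st3, st2, st1, st0, fileOf_cons]

/-! ### One refinement step on the kernel file -/

section KStep

attribute [-simp] Sum.elim_update_left Sum.elim_update_right

variable (z : List Bool)

/-- The cost of the set-up at depth `d`. [folklore] -/
def setupCost (d : ℕ) : ℕ := 39 * d + 65

/-- **Simulation of `setupC`.** [cite: Kitaev1995, §3 Lemma 10] -/
theorem runs_setupC (KP ks AA LC OUT : List Bool) (d : ℕ) :
    Runs setupC (S (kf z ⟨KP, ks, AA, ones (d + 1), LC, [], [], [], [], [], [], [], OUT⟩) [] [] [])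
      (S (kf z ⟨KP, ks.drop 2, AA, ones (d + 1), LC,
        List.replicate (d + 1) false ++ encodeNat (kq (ks.getD 1 false) (ks.getD 0 false)),
        pw (d + 4), pw (d + 3), [], [], [], [], OUT⟩) [] [] []) (setupCost d) := by
  set k := kq (ks.getD 1 false) (ks.getD 0 false) with hk
  have h1 := runs_mkK (T := kf z ⟨KP, ks, AA, ones (d + 1), LC, [], [], [], [], [], [], [], OUT⟩) rfl ks [] [] [] rfl
  rw [← hk] at h1
  simp only [update_kf_KS, update_kf_V] at h1
  have h2 := runs_shl (clean_kf z _) (r := .V) (by decide) rfl [] [] []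
    (T := kf z ⟨KP, ks.drop 2, AA, ones (d + 1), LC, encodeNat k, [], [], [], [], [], [], OUT⟩)
  simp only [update_kf_V, kf_DC, kf_V, ones, List.length_replicate] at h2
  have h3 := runs_mkPow (clean_kf z _) (r := .NB) (by decide) (by decide) (by decide) (by decide) rfl rfl 3 [] [] []
    (T := kf z ⟨KP, ks.drop 2, AA, ones (d + 1), LC, List.replicate (d + 1) false ++ encodeNat k, [], [], [], [], [], [], OUT⟩)
  simp only [update_kf_NB, kf_DC, ones, List.length_replicate] at h3
  have h4 := runs_mkPow (clean_kf z _) (r := .HF) (by decide) (by decide) (by decide) (by decide) rfl rfl 2 [] [] []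
    (T := kf z ⟨KP, ks.drop 2, AA, ones (d + 1), LC, List.replicate (d + 1) false ++ encodeNat k,
      List.replicate (d + 1 + 3) false ++ [true], [], [], [], [], [], OUT⟩)
  simp only [update_kf_HF, kf_DC, ones, List.length_replicate] at h4
  refine (h1.seq (h2.seq (h3.seq h4))).of_eq ?_ (by rw [setupCost]; omega)
  simp only [ones, pw, show d + 1 + 3 = d + 4 by omega, show d + 1 + 2 = d + 3 by omega]

/-- The cost of the two distances at depth `d`. [folklore] -/
def distsCost (d : ℕ) : ℕ := 756 * d + 4274

/-- **Simulation of `distsC`**: the two modular distances land in `MA`, `MB` (as some numerals of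
bounded length) and the flag records their comparison. [cite: Kitaev1995, §3 Lemma 10] -/
theorem runs_distsC (KP ks LC OUT : List Bool) (a d k : ℕ) (ha : a < 2 ^ (d + 3)) (hk : k < 8) :
    ∃ m1 m2 : List Bool, m1.length ≤ d + 6 ∧ m2.length ≤ d + 6 ∧
      Runs distsC
        (S (kf z ⟨KP, ks, encodeNat a, ones (d + 1), LC, List.replicate (d + 1) false ++ encodeNat k,
          pw (d + 4), pw (d + 3), [], [], [], [], OUT⟩) [] [] [])
        (S (kf z ⟨KP, ks, encodeNat a, ones (d + 1), LC, List.replicate (d + 1) false ++ encodeNat k,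
          pw (d + 4), pw (d + 3), [], m1, m2, [], OUT⟩) [] []
          (flag (decide (mdist d (k * 2 ^ (d + 1)) a ≤ mdist d (k * 2 ^ (d + 1)) (a + 2 ^ (d + 3))))))
        (distsCost d) := by
  set H := 2 ^ (d + 3) with hH
  have hN2 : (2 : ℕ) ^ (d + 4) = 2 * H := by rw [hH, pow_succ]; ring
  have hal : (encodeNat a).length ≤ d + 3 := length_encodeNat_le_of_lt ha
  set vl := List.replicate (d + 1) false ++ encodeNat k with hvl
  have hvlv : bitsToNat vl = k * 2 ^ (d + 1) := by
    rw [hvl, bitsToNat_append, bitsToNat_replicate_false, bitsToNat_encodeNat, List.length_replicate]; ring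
  have hkl : (encodeNat k).length ≤ 3 := length_encodeNat_le_of_lt (by simpa using hk)
  have hvll : vl.length ≤ d + 4 := by rw [hvl, List.length_append, List.length_replicate]; omega
  have hvN : k * 2 ^ (d + 1) < 2 ^ (d + 4) := by
    have h8 : 2 ^ (d + 4) = 8 * 2 ^ (d + 1) := by rw [show d + 4 = 3 + (d + 1) by omega, pow_add]; norm_num
    have hp : 0 < 2 ^ (d + 1) := by positivity
    rw [h8]; nlinarith
  -- the register-file predicate of `runs_distC`, for any `MA`
  have hS : ∀ ma : List Bool, StepRegs (kf z ⟨KP, ks, encodeNat a, ones (d + 1), LC, vl, pw (d + 4), pw (d + 3), [], ma, [], [], OUT⟩)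
      d (k * 2 ^ (d + 1)) := fun ma =>
    { clean := clean_kf z _, nb := rfl, hf := rfl, v_val := hvlv, v_len := hvll, v_lt := hvN, w1 := rfl }
  -- 1./2. the first distance
  have h1 := runs_ldx (clean_kf z ⟨KP, ks, encodeNat a, ones (d + 1), LC, vl, pw (d + 4), pw (d + 3), [], [], [], [], OUT⟩)
    (r := .AA) (by decide) (by decide) [] []
  simp only [kf_AA] at h1
  obtain ⟨m1, hm1v, hm1l, h2⟩ := runs_distC (hS []) (m := .MA) (by decide) (by decide) rfl (encodeNat a) a
    (bitsToNat_encodeNat a) (by omega) (by omega)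
  simp only [update_kf_MA] at h2
  -- 3./4./5. the second distance
  have h3 := runs_ldx (clean_kf z ⟨KP, ks, encodeNat a, ones (d + 1), LC, vl, pw (d + 4), pw (d + 3), [], m1, [], [], OUT⟩)
    (r := .AA) (by decide) (by decide) [] []
  simp only [kf_AA] at h3
  have h4 := runs_addR (clean_kf z ⟨KP, ks, encodeNat a, ones (d + 1), LC, vl, pw (d + 4), pw (d + 3), [], m1, [], [], OUT⟩)
    (r := .HF) (by decide) (by decide) (encodeNat a) []
  simp only [kf_HF] at h4
  set xb := addRes (encodeNat a) (pw (d + 3)) with hxb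
  have hxbv : bitsToNat xb = a + H := by rw [hxb, bitsToNat_addRes, bitsToNat_encodeNat, bitsToNat_pw]
  have hxbl : xb.length ≤ d + 5 := by
    have := length_addRes_le_max (encodeNat a) (pw (d + 3))
    rw [length_pw, max_eq_right (by omega)] at this
    rw [hxb]; omega
  obtain ⟨m2, hm2v, hm2l, h5⟩ := runs_distC (hS m1) (m := .MB) (by decide) (by decide) rfl xb (a + H) hxbv (by omega) hxbl
  simp only [update_kf_MB] at h5
  -- 6./7. compare
  have h6 := runs_ldx (clean_kf z ⟨KP, ks, encodeNat a, ones (d + 1), LC, vl, pw (d + 4), pw (d + 3), [], m1, m2, [], OUT⟩)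
    (r := .MB) (by decide) (by decide) [] []
  simp only [kf_MB] at h6
  have h7 := runs_cmpR (clean_kf z ⟨KP, ks, encodeNat a, ones (d + 1), LC, vl, pw (d + 4), pw (d + 3), [], m1, m2, [], OUT⟩)
    (r := .MA) (by decide) (by decide) m2
  simp only [kf_MA, hm1v, hm2v] at h7
  refine ⟨m1, m2, hm1l, hm2l, (h1.seq (h2.seq (h3.seq (h4.seq (h5.seq (h6.seq h7)))))).of_eq rfl ?_⟩
  rw [distsCost, distCost, length_pw]
  omega

/-- The cost of the clean-up (lengths of the five cleared registers `n`). [folklore] -/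
def cleanCost (n : ℕ) : ℕ := 2 * n + 6

/-- **Simulation of `cleanC`.** [folklore] -/
theorem runs_cleanC (KP ks AA DC LC v nb hf ma mb OUT : List Bool) :
    Runs cleanC (S (kf z ⟨KP, ks, AA, DC, LC, v, nb, hf, [], ma, mb, [], OUT⟩) [] [] [])
      (S (kf z ⟨KP, ks, AA, true :: DC, LC, [], [], [], [], [], [], [], OUT⟩) [] [] [])
      (cleanCost (v.length + nb.length + hf.length + ma.length + mb.length)) := by
  have c1 : Runs (clear (o .V) : Com RR) (S (kf z ⟨KP, ks, AA, DC, LC, v, nb, hf, [], ma, mb, [], OUT⟩) [] [] [])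
      (S (kf z ⟨KP, ks, AA, DC, LC, [], nb, hf, [], ma, mb, [], OUT⟩) [] [] []) (2 * v.length + 1) :=
    (runs_clear (o .V) _).of_eq (by simp [S]) (by simp [S])
  have c2 : Runs (clear (o .NB) : Com RR) (S (kf z ⟨KP, ks, AA, DC, LC, [], nb, hf, [], ma, mb, [], OUT⟩) [] [] [])
      (S (kf z ⟨KP, ks, AA, DC, LC, [], [], hf, [], ma, mb, [], OUT⟩) [] [] []) (2 * nb.length + 1) :=
    (runs_clear (o .NB) _).of_eq (by simp [S]) (by simp [S])
  have c3 : Runs (clear (o .HF) : Com RR) (S (kf z ⟨KP, ks, AA, DC, LC, [], [], hf, [], ma, mb, [], OUT⟩) [] [] [])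
      (S (kf z ⟨KP, ks, AA, DC, LC, [], [], [], [], ma, mb, [], OUT⟩) [] [] []) (2 * hf.length + 1) :=
    (runs_clear (o .HF) _).of_eq (by simp [S]) (by simp [S])
  have c4 : Runs (clear (o .MA) : Com RR) (S (kf z ⟨KP, ks, AA, DC, LC, [], [], [], [], ma, mb, [], OUT⟩) [] [] [])
      (S (kf z ⟨KP, ks, AA, DC, LC, [], [], [], [], [], mb, [], OUT⟩) [] [] []) (2 * ma.length + 1) :=
    (runs_clear (o .MA) _).of_eq (by simp [S]) (by simp [S])
  have c5 : Runs (clear (o .MB) : Com RR) (S (kf z ⟨KP, ks, AA, DC, LC, [], [], [], [], [], mb, [], OUT⟩) [] [] [])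
      (S (kf z ⟨KP, ks, AA, DC, LC, [], [], [], [], [], [], [], OUT⟩) [] [] []) (2 * mb.length + 1) :=
    (runs_clear (o .MB) _).of_eq (by simp [S]) (by simp [S])
  have c6 : Runs (push (o .DC) true : Com RR) (S (kf z ⟨KP, ks, AA, DC, LC, [], [], [], [], [], [], [], OUT⟩) [] [] [])
      (S (kf z ⟨KP, ks, AA, true :: DC, LC, [], [], [], [], [], [], [], OUT⟩) [] [] []) 1 :=
    Runs.push' (by simp [S])
  exact (c1.seq (c2.seq (c3.seq (c4.seq (c5.seq c6))))).of_eq rfl (by rw [cleanCost]; omega)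

/-- The cost of one refinement step at depth `d`. [folklore] -/
def stepCost (d : ℕ) : ℕ := 900 * d + 5000

/-- `stepCost` is monotone. [folklore] -/
theorem stepCost_mono {d d' : ℕ} (h : d ≤ d') : stepCost d ≤ stepCost d' := by unfold stepCost; omega

/-- **Simulation of one refinement step on the kernel file**: from `a` at depth `d + 1` with the
unread bits `ks`, two bits are consumed, `AA` becomes the numeral of `stepVal a d k` and the depth
counter grows. [cite: Kitaev1995, §3 Lemma 10] -/
theorem runs_stepC (KP ks LC OUT : List Bool) (a d : ℕ) (ha : a < 2 ^ (d + 3)) :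
    Runs stepC (S (kf z ⟨KP, ks, encodeNat a, ones (d + 1), LC, [], [], [], [], [], [], [], OUT⟩) [] [] [])
      (S (kf z ⟨KP, ks.drop 2, encodeNat (stepVal a d (kq (ks.getD 1 false) (ks.getD 0 false))), ones (d + 2), LC,
        [], [], [], [], [], [], [], OUT⟩) [] [] []) (stepCost d) := by
  set k := kq (ks.getD 1 false) (ks.getD 0 false) with hk
  have hk8 : k < 8 := kq_lt _ _
  have h1 := runs_setupC z KP ks (encodeNat a) LC OUT d
  rw [← hk] at h1
  obtain ⟨m1, m2, hm1l, hm2l, h2⟩ := runs_distsC z KP (ks.drop 2) LC OUT a d k ha hk8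
  set b := decide (mdist d (k * 2 ^ (d + 1)) a ≤ mdist d (k * 2 ^ (d + 1)) (a + 2 ^ (d + 3))) with hb
  have h3 := runs_branchC (clean_kf z ⟨KP, ks.drop 2, encodeNat a, ones (d + 1), LC,
      List.replicate (d + 1) false ++ encodeNat k, pw (d + 4), pw (d + 3), [], m1, m2, [], OUT⟩) (a := a) (d := d) rfl rfl ha b
  simp only [update_kf_AA] at h3
  have hval : (bif b then a else a + 2 ^ (d + 3)) = stepVal a d k := by
    rw [stepVal, hb]; by_cases h : mdist d (k * 2 ^ (d + 1)) a ≤ mdist d (k * 2 ^ (d + 1)) (a + 2 ^ (d + 3))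
    · rw [decide_eq_true h, if_pos h]; rfl
    · rw [decide_eq_false h, if_neg h]; rfl
  rw [hval] at h3
  have h4 := runs_cleanC z KP (ks.drop 2) (encodeNat (stepVal a d k)) (ones (d + 1)) LC
    (List.replicate (d + 1) false ++ encodeNat k) (pw (d + 4)) (pw (d + 3)) m1 m2 OUT
  have hkl : (encodeNat k).length ≤ 3 := length_encodeNat_le_of_lt (by simpa using hk8)
  refine (h1.seq (h2.seq (h3.seq h4))).of_eq (by rfl) ?_
  rw [stepCost, setupCost, distsCost, branchCost, cleanCost, List.length_append, List.length_replicate, length_pw, length_pw]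
  omega

end KStep

/-! ### One trial on the kernel file -/

section KTrial

attribute [-simp] Sum.elim_update_left Sum.elim_update_right

variable (z : List Bool)

/-- The first `n` bits of a stream, stacked (reversed; missing bits read `0`). [folklore] -/
def rd (kp : List Bool) (n : ℕ) : List Bool := ((List.range n).map fun j => kp.getD j false).reverse

/-- `rd` of no bits. [folklore] -/
@[simp] theorem rd_zero (kp : List Bool) : rd kp 0 = [] := by simp [rd]

/-- `rd` of one more bit. [folklore] -/
theorem rd_succ (kp : List Bool) (n : ℕ) : rd kp (n + 1) = kp.getD n false :: rd kp n := by
  simp [rd, List.range_succ]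

/-- Reading a dropped stream. [folklore] -/
theorem getD_drop (kp : List Bool) (i j : ℕ) : (kp.drop i).getD j false = kp.getD (i + j) false := by
  rw [List.getD_eq_getElem?_getD, List.getElem?_drop, ← List.getD_eq_getElem?_getD]

/-- The level numerators of the trial at the head of the stream `kp`. [cite: Kitaev1995, §3 (before Lemma 9)] -/
def kapT (kp : List Bool) (l : ℕ) : ℕ := kq (kp.getD (2 * l) false) (kp.getD (2 * l + 1) false)

/-- `kapT < 8`. [folklore] -/
theorem kapT_lt (kp : List Bool) (l : ℕ) : kapT kp l < 8 := kq_lt _ _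

/-- The numerators of trial `t` are those at the head of the stream advanced by `2Lt` bits. [folklore] -/
theorem kapT_drop (kp : List Bool) (L t : ℕ) : kapT (kp.drop (2 * L * t)) = kapOf L kp t := by
  funext l; simp [kapT, kapOf, Nat.add_assoc]

/-- **Simulation of `rd2`**: one bit moves from the stream to the stack. [folklore] -/
theorem runs_rd2 (kp ks AA DC LC OUT : List Bool) :
    Runs rd2 (S (kf z ⟨kp, ks, AA, DC, LC, [], [], [], [], [], [], [], OUT⟩) [] [] [])
      (S (kf z ⟨kp.drop 1, kp.getD 0 false :: ks, AA, DC, LC, [], [], [], [], [], [], [], OUT⟩) [] [] []) 3 := by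
  rcases kp with _ | ⟨b, rest⟩
  · exact (Runs.pop_nil _ _ (by simp [S]) (Runs.push (o .KS) false _)).of_eq (by simp [S]) (by omega)
  · cases b
    · exact (Runs.pop_false _ _ (w := rest) (by simp [S]) (Runs.push (o .KS) false _)).of_eq (by simp [S]) (by omega)
    · exact (Runs.pop_true _ _ (w := rest) (by simp [S]) (Runs.push (o .KS) true _)).of_eq (by simp [S]) (by omega)

/-- Two bits. [folklore] -/
theorem runs_rd2_rd2 (kp ks AA DC LC OUT : List Bool) (i : ℕ) :
    Runs (rd2 ;; rd2) (S (kf z ⟨kp.drop (2 * i), rd kp (2 * i) ++ ks, AA, DC, LC, [], [], [], [], [], [], [], OUT⟩) [] [] [])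
      (S (kf z ⟨kp.drop (2 * (i + 1)), rd kp (2 * (i + 1)) ++ ks, AA, DC, LC, [], [], [], [], [], [], [], OUT⟩) [] [] []) 6 := by
  rw [show 2 * (i + 1) = 2 * i + 1 + 1 by ring, rd_succ, rd_succ]
  refine ((runs_rd2 z _ _ AA DC LC OUT).seq (runs_rd2 z _ _ AA DC LC OUT)).of_eq ?_ (by omega)
  simp only [List.drop_drop, getD_drop, Nat.add_zero, List.cons_append]

/-- **Simulation of `readC`**: `2|LC|` bits move from the stream to the stack. [folklore] -/
theorem runs_readC (kp ks AA DC OUT : List Bool) (m : ℕ) :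
    Runs readC (S (kf z ⟨kp, ks, AA, DC, ones m, [], [], [], [], [], [], [], OUT⟩) [] [] [])
      (S (kf z ⟨kp.drop (2 * m), rd kp (2 * m) ++ ks, AA, DC, [], [], [], [], [], [], [], [], OUT⟩) [] [] []) (8 * m + 1) := by
  have h := runs_indexLoop (c := o .LC) (body := (rd2 ;; rd2 : Com RR))
    (fun i => S (kf z ⟨kp.drop (2 * i), rd kp (2 * i) ++ ks, AA, DC, [], [], [], [], [], [], [], [], OUT⟩) [] [] []) 6
    (fun i => rfl) (ones m) 0 (fun i _ _ w => by
      simp only [S, Sum.update_elim_inl, update_kf_LC]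
      exact runs_rd2_rd2 z kp ks AA DC w OUT i)
  simp only [S, Sum.update_elim_inl, update_kf_LC, Nat.mul_zero, List.drop_zero, rd_zero, List.nil_append, Nat.zero_add,
    List.length_replicate] at h
  exact h.of_eq rfl (by omega)

/-- The cost of the kernel of a trial with `m = 2ℓ` refinement steps. [folklore] -/
def coreCost (m : ℕ) : ℕ := (stepCost m + 2) * m + 28 * m + 45

/-- **Simulation of the kernel of a trial** (`m = 2ℓ`, `L = m + 1` levels): `2L` bits are consumed
and `AA` holds the numeral of `refineNat κ L (L − 1)` for the numerators `κ = kapT kp` at the head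
of the stream. [cite: Kitaev1995, §3 Lemma 10] -/
theorem runs_trialCore (kp OUT : List Bool) :
    Runs trialCore (S (kf z ⟨kp, [], [], [], [], [], [], [], [], [], [], [], OUT⟩) [] [] [])
      (S (kf z ⟨kp.drop (2 * (ell z + ell z + 1)), [], encodeNat (refineNat (kapT kp) (ell z + ell z + 1) (ell z + ell z)),
        ones (ell z + ell z + 1), [], [], [], [], [], [], [], [], OUT⟩) [] [] []) (coreCost (ell z + ell z)) := by
  set m := ell z + ell z with hm
  set κ := kapT kp with hκ
  have hκ8 : ∀ l, κ l < 8 := kapT_lt kp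
  -- 1. LC := 1^m
  have h1 : Runs (copy (o .LV) (o .LC) (o .T1) (o .Tx) : Com RR) (S (kf z ⟨kp, [], [], [], [], [], [], [], [], [], [], [], OUT⟩) [] [] [])
      (S (kf z ⟨kp, [], [], [], ones m, [], [], [], [], [], [], [], OUT⟩) [] [] []) (10 * m + 3) := by
    refine (runs_copy (a := o .LV) (b := o .LC) (t := o .T1) (u := o .Tx) (by decide) (by decide) (by decide) (by decide)
      (by decide) (by decide) _ rfl rfl).of_eq ?_ ?_
    · simp [S, hm]
    · simp [S, hm]
  -- 2. one more level
  have h2 : Runs (push (o .LC) true : Com RR) (S (kf z ⟨kp, [], [], [], ones m, [], [], [], [], [], [], [], OUT⟩) [] [] [])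
      (S (kf z ⟨kp, [], [], [], ones (m + 1), [], [], [], [], [], [], [], OUT⟩) [] [] []) 1 :=
    Runs.push' (by simp [S]; rfl)
  -- 3. read the bits
  have h3 := runs_readC z kp [] [] [] OUT (m + 1)
  rw [List.append_nil, show 2 * (m + 1) = 2 * m + 1 + 1 by ring, rd_succ, rd_succ] at h3
  -- 4. level 0
  have h4 := runs_mkK (T := kf z ⟨kp.drop (2 * m + 1 + 1), kp.getD (2 * m + 1) false :: kp.getD (2 * m) false :: rd kp (2 * m),
    [], [], [], [], [], [], [], [], [], [], OUT⟩) rfl _ [] [] [] rfl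
  simp only [update_kf_KS, update_kf_V, kf_KS, List.drop_succ_cons, List.drop_zero, List.getD_cons_succ, List.getD_cons_zero] at h4
  have hk0 : kq (kp.getD (2 * m) false) (kp.getD (2 * m + 1) false) = refineNat κ (m + 1) 0 := by
    rw [refineNat, hκ, kapT, Nat.add_sub_cancel]
  rw [hk0] at h4
  -- 5. AA := V
  have h5 : Runs (move (o .V) (o .AA) (o .T1) : Com RR)
      (S (kf z ⟨kp.drop (2 * m + 1 + 1), rd kp (2 * m), [], [], [], encodeNat (refineNat κ (m + 1) 0), [], [], [], [], [], [], OUT⟩) [] [] [])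
      (S (kf z ⟨kp.drop (2 * m + 1 + 1), rd kp (2 * m), encodeNat (refineNat κ (m + 1) 0), [], [], [], [], [], [], [], [], [], OUT⟩) [] [] [])
      20 := by
    have hl : (encodeNat (refineNat κ (m + 1) 0)).length ≤ 3 :=
      length_encodeNat_le_of_lt (by have := refineNat_lt hκ8 (m + 1) 0; simpa using this)
    refine (runs_move (a := o .V) (b := o .AA) (t := o .T1) (by decide) (by decide) (by decide) _ (by simp [S])).of_eq
      (by simp [S]) ?_
    simp [S]; omega
  -- 6. depth 1
  have h6 : Runs (push (o .DC) true : Com RR)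
      (S (kf z ⟨kp.drop (2 * m + 1 + 1), rd kp (2 * m), encodeNat (refineNat κ (m + 1) 0), [], [], [], [], [], [], [], [], [], OUT⟩) [] [] [])
      (S (kf z ⟨kp.drop (2 * m + 1 + 1), rd kp (2 * m), encodeNat (refineNat κ (m + 1) 0), ones 1, [], [], [], [], [], [], [], [], OUT⟩) [] [] [])
      1 := Runs.push' (by simp [S])
  -- 7. LC := 1^m
  have h7 : Runs (copy (o .LV) (o .LC) (o .T1) (o .Tx) : Com RR)
      (S (kf z ⟨kp.drop (2 * m + 1 + 1), rd kp (2 * m), encodeNat (refineNat κ (m + 1) 0), ones 1, [], [], [], [], [], [], [], [], OUT⟩) [] [] [])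
      (S (kf z ⟨kp.drop (2 * m + 1 + 1), rd kp (2 * m), encodeNat (refineNat κ (m + 1) 0), ones 1, ones m, [], [], [], [], [], [], [], OUT⟩) [] [] [])
      (10 * m + 3) := by
    refine (runs_copy (a := o .LV) (b := o .LC) (t := o .T1) (u := o .Tx) (by decide) (by decide) (by decide) (by decide)
      (by decide) (by decide) _ rfl rfl).of_eq ?_ ?_
    · simp [S, hm]
    · simp [S, hm]
  -- 8. the refinement loop
  have h8 := runs_indexLoop (c := o .LC) (body := stepC)
    (fun i => S (kf z ⟨kp.drop (2 * m + 1 + 1), rd kp (2 * (m - i)), encodeNat (refineNat κ (m + 1) i), ones (i + 1),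
      [], [], [], [], [], [], [], [], OUT⟩) [] [] []) (stepCost m) (fun i => rfl) (ones m) 0 (fun i _ hi w => by
      simp only [Nat.zero_add, List.length_replicate] at hi
      simp only [S, Sum.update_elim_inl, update_kf_LC]
      have ha : refineNat κ (m + 1) i < 2 ^ (i + 3) := by
        have := refineNat_lt hκ8 (m + 1) i; rw [pow_add]; norm_num; linarith
      obtain ⟨n, hn⟩ : ∃ n, m - i = n + 1 := ⟨m - i - 1, by omega⟩
      have hn' : m - (i + 1) = n := by omega
      have hstep := runs_stepC z (kp.drop (2 * m + 1 + 1)) (rd kp (2 * (m - i))) w OUT (refineNat κ (m + 1) i) i ha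
      rw [hn, show 2 * (n + 1) = 2 * n + 1 + 1 by ring, rd_succ, rd_succ] at hstep ⊢
      simp only [List.drop_succ_cons, List.drop_zero, List.getD_cons_succ, List.getD_cons_zero] at hstep
      refine hstep.of_eq ?_ (stepCost_mono (by omega))
      rw [hn', refineNat_succ, show m + 1 - 1 - (i + 1) = n by omega, hκ, kapT])
  simp only [S, Sum.update_elim_inl, update_kf_LC, Nat.sub_zero, Nat.zero_add, List.length_replicate, Nat.sub_self,
    Nat.mul_zero, rd_zero] at h8
  refine (h1.seq (h2.seq (h3.seq (h4.seq (h5.seq (h6.seq (h7.seq h8))))))).of_eq rfl ?_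
  rw [coreCost]; ring_nf; omega

/-- The refined numerator of the trial at the head of the stream. [cite: Kitaev1995, §3 Lemma 10] -/
def aT (kp : List Bool) : ℕ := refineNat (kapT kp) (ell z + ell z + 1) (ell z + ell z)

/-- `aT < 2^{2ℓ+3}`. [folklore] -/
theorem aT_lt (kp : List Bool) : aT z kp < 2 ^ (ell z + ell z + 3) := by
  have := refineNat_lt (kapT_lt kp) (ell z + ell z + 1) (ell z + ell z)
  rw [aT, pow_add]; norm_num; linarith

/-- The cost of one trial (`m = 2ℓ`). [folklore] -/
def trialCost (m : ℕ) : ℕ := coreCost m + 6 * m + 18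

/-- `trialCost` is monotone. [folklore] -/
theorem trialCost_mono {m m' : ℕ} (h : m ≤ m') : trialCost m ≤ trialCost m' := by
  unfold trialCost coreCost stepCost
  have : (900 * m + 5000 + 2) * m ≤ (900 * m' + 5000 + 2) * m' := Nat.mul_le_mul (by omega) h
  omega

/-- **Simulation of a trial emitting its numerator as a pair component.** [folklore] -/
theorem runs_trialC_emit (kp OUT : List Bool) :
    Runs (trialC (emit (o .AA) (o .OUT))) (S (kf z ⟨kp, [], [], [], [], [], [], [], [], [], [], [], OUT⟩) [] [] [])
      (S (kf z ⟨kp.drop (2 * (ell z + ell z + 1)), [], [], [], [], [], [], [], [], [], [], [], emitted (encodeNat (aT z kp)) OUT⟩) [] [] [])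
      (trialCost (ell z + ell z)) := by
  set m := ell z + ell z with hm
  have hl : (encodeNat (aT z kp)).length ≤ m + 3 := length_encodeNat_le_of_lt (aT_lt z kp)
  have h1 := runs_trialCore z kp OUT
  rw [← hm] at h1
  have h2 : Runs (emit (o .AA) (o .OUT) : Com RR)
      (S (kf z ⟨kp.drop (2 * (m + 1)), [], encodeNat (aT z kp), ones (m + 1), [], [], [], [], [], [], [], [], OUT⟩) [] [] [])
      (S (kf z ⟨kp.drop (2 * (m + 1)), [], [], ones (m + 1), [], [], [], [], [], [], [], [], emitted (encodeNat (aT z kp)) OUT⟩) [] [] [])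
      (4 * (encodeNat (aT z kp)).length + 3) :=
    (runs_emit (h := o .AA) (o := o .OUT) (by decide) _).of_eq (by simp [S, emitted]) (by simp [S])
  have h3 : Runs (clear (o .DC) : Com RR)
      (S (kf z ⟨kp.drop (2 * (m + 1)), [], [], ones (m + 1), [], [], [], [], [], [], [], [], emitted (encodeNat (aT z kp)) OUT⟩) [] [] [])
      (S (kf z ⟨kp.drop (2 * (m + 1)), [], [], [], [], [], [], [], [], [], [], [], emitted (encodeNat (aT z kp)) OUT⟩) [] [] [])
      (2 * (m + 1) + 1) :=
    (runs_clear (o .DC) _).of_eq (by simp [S]) (by simp [S])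
  refine (h1.seq (h2.seq h3)).of_eq (by simp [aT, hm]) ?_
  rw [trialCost]; omega

/-- **Simulation of the last trial, pouring its numerator.** [folklore] -/
theorem runs_trialC_pour (kp OUT : List Bool) :
    Runs (trialC (pour (o .AA) (o .OUT))) (S (kf z ⟨kp, [], [], [], [], [], [], [], [], [], [], [], OUT⟩) [] [] [])
      (S (kf z ⟨kp.drop (2 * (ell z + ell z + 1)), [], [], [], [], [], [], [], [], [], [], [], (encodeNat (aT z kp)).reverse ++ OUT⟩) [] [] [])
      (trialCost (ell z + ell z)) := by
  set m := ell z + ell z with hm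
  have hl : (encodeNat (aT z kp)).length ≤ m + 3 := length_encodeNat_le_of_lt (aT_lt z kp)
  have h1 := runs_trialCore z kp OUT
  rw [← hm] at h1
  have h2 : Runs (pour (o .AA) (o .OUT) : Com RR)
      (S (kf z ⟨kp.drop (2 * (m + 1)), [], encodeNat (aT z kp), ones (m + 1), [], [], [], [], [], [], [], [], OUT⟩) [] [] [])
      (S (kf z ⟨kp.drop (2 * (m + 1)), [], [], ones (m + 1), [], [], [], [], [], [], [], [], (encodeNat (aT z kp)).reverse ++ OUT⟩) [] [] [])
      (3 * (encodeNat (aT z kp)).length + 1) :=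
    (runs_pour (a := o .AA) (b := o .OUT) (by decide) _).of_eq (by simp [S]) (by simp [S])
  have h3 : Runs (clear (o .DC) : Com RR)
      (S (kf z ⟨kp.drop (2 * (m + 1)), [], [], ones (m + 1), [], [], [], [], [], [], [], [], (encodeNat (aT z kp)).reverse ++ OUT⟩) [] [] [])
      (S (kf z ⟨kp.drop (2 * (m + 1)), [], [], [], [], [], [], [], [], [], [], [], (encodeNat (aT z kp)).reverse ++ OUT⟩) [] [] [])
      (2 * (m + 1) + 1) :=
    (runs_clear (o .DC) _).of_eq (by simp [S]) (by simp [S])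
  refine (h1.seq (h2.seq h3)).of_eq (by simp [aT, hm]) ?_
  rw [trialCost]; omega

end KTrial

/-! ### The whole program -/

section Main

attribute [-simp] Sum.elim_update_left Sum.elim_update_right
attribute [local simp] st0 st1 st2 st3 st4 st5 st6 st7 st8 st9 st10 st11 parsed update_fileOf fileOf_cons

/-- The initial register file is the embedded stage-0 file. [folklore] -/
theorem init_eq_S (z : List Bool) : Regs.init (o .inp) z = S (fileOf (st0 z)) [] [] [] := by
  funext r
  rcases r with k | a
  · by_cases hk : k = K.inp
    · subst hk; simp [S, fileOf, List.lookup, st0, Regs.init]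
    · have h2 : (k == K.inp) = false := beq_false_of_ne hk
      simp [S, fileOf, List.lookup, st0, Regs.init, hk, h2]
  · cases a <;> simp [S, Regs.init]

/-- `ℓ ≤ |z|`. [folklore] -/
theorem ell_le (z : List Bool) : ell z ≤ z.length :=
  (length_boolUnpair_fst_le _).trans ((length_boolUnpair_snd_le z).trans le_rfl)

/-- The numerator of trial `t` computed by the machine is `aOf`. [folklore] -/
theorem aT_drop (z : List Bool) (t : ℕ) : aT z ((pK z).drop (2 * (ell z + ell z + 1) * t)) = aOf (ell z + ell z + 1) (pK z) t := by
  rw [aT, kapT_drop, aOf, Nat.add_sub_cancel]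

/-- The cost of the whole program in terms of the input length. [folklore] -/
def progCost (s : ℕ) : ℕ := parseCost s + 4 * trialCost (s + s) + (60 * s + 120)

/-- **Simulation of the whole program**: on every input `z` it leaves `stageA2 z` in `RES` within
`progCost |z|` steps. [folklore] -/
theorem runs_prog (z : List Bool) :
    ∃ Rf : Regs RR, Runs prog (Regs.init (o .inp) z) Rf (progCost z.length) ∧ Rf (o .RES) = stageA2 z := by
  rw [init_eq_S]
  set D := 2 * (ell z + ell z + 1) with hD
  set kp := pK z with hkp
  set OUT0 := emitted (ones (ell z)) (emitted (pN z) []) with hOUT0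
  have hp := runs_parse z
  rw [parsed_eq_kf, ← hkp] at hp
  have t1 := runs_trialC_emit z kp OUT0
  have t2 := runs_trialC_emit z (kp.drop D) (emitted (encodeNat (aT z kp)) OUT0)
  have t3 := runs_trialC_emit z ((kp.drop D).drop D) (emitted (encodeNat (aT z (kp.drop D))) (emitted (encodeNat (aT z kp)) OUT0))
  have t4 := runs_trialC_pour z (((kp.drop D).drop D).drop D)
    (emitted (encodeNat (aT z ((kp.drop D).drop D))) (emitted (encodeNat (aT z (kp.drop D))) (emitted (encodeNat (aT z kp)) OUT0)))
  rw [← hD] at t1 t2 t3 t4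
  set OUT4 := (encodeNat (aT z (((kp.drop D).drop D).drop D))).reverse ++
    emitted (encodeNat (aT z ((kp.drop D).drop D))) (emitted (encodeNat (aT z (kp.drop D))) (emitted (encodeNat (aT z kp)) OUT0))
    with hOUT4
  have h5 := runs_pour (a := o .OUT) (b := o .RES) (by decide)
    (S (kf z ⟨(((kp.drop D).drop D).drop D).drop D, [], [], [], [], [], [], [], [], [], [], [], OUT4⟩) [] [] [])
  have hA : ∀ w : List Bool, (encodeNat (aT z w)).length ≤ ell z + ell z + 3 := fun w => length_encodeNat_le_of_lt (aT_lt z w)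
  have hOUTlen : OUT4.length ≤ 18 * z.length + 31 := by
    have hℓ := ell_le z
    have hN : (pN z).length ≤ z.length := length_boolUnpair_fst_le z
    have hdbl : ∀ l : List Bool, (l.flatMap fun b => [b, b]).length = 2 * l.length := fun l => by
      induction l with
      | nil => rfl
      | cons b l ih => simp [List.flatMap_cons, ih]; ring
    have e : ∀ v rest : List Bool, (emitted v rest).length = 2 * v.length + 2 + rest.length := fun v rest => by
      simp [emitted, hdbl]; ring
    have a1 := hA kp; have a2 := hA (kp.drop D); have a3 := hA ((kp.drop D).drop D); have a4 := hA (((kp.drop D).drop D).drop D)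
    rw [hOUT4]
    simp only [List.length_append, List.length_reverse, e, hOUT0, List.length_replicate, List.length_nil]
    omega
  refine ⟨_, (hp.seq (t1.seq (t2.seq (t3.seq (t4.seq h5))))).of_eq rfl ?_, ?_⟩
  · -- cost
    have hℓ := ell_le z
    have ht : trialCost (ell z + ell z) ≤ trialCost (z.length + z.length) := trialCost_mono (by omega)
    have : (S (kf z ⟨(((kp.drop D).drop D).drop D).drop D, [], [], [], [], [], [], [], [], [], [], [], OUT4⟩) [] [] [] (o .OUT)).length
        = OUT4.length := rfl
    rw [progCost, this]
    omega
  · -- the output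
    simp only [S, Sum.update_elim_inl, Sum.elim_inl, update_kf_OUT, Function.update_self, kf_OUT, kf_RES, List.append_nil]
    have e2 : (kp.drop D).drop D = kp.drop (D * 2) := by rw [List.drop_drop, Nat.mul_two]
    have e3 : ((kp.drop D).drop D).drop D = kp.drop (D * 3) := by
      rw [List.drop_drop, List.drop_drop]; congr 1; ring
    have a0 := aT_drop z 0
    have a1 := aT_drop z 1
    have a2 := aT_drop z 2
    have a3 := aT_drop z 3
    simp only [Nat.mul_zero, List.drop_zero, Nat.mul_one, ← hkp, ← hD] at a0 a1 a2 a3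
    rw [hOUT4, e3, e2, a0, a1, a2, a3, hOUT0, stageA2]
    simp only [emitted, boolPair, List.reverse_append, List.reverse_cons, List.reverse_reverse, List.reverse_nil,
      List.append_assoc, List.cons_append, List.nil_append]
    simp [pN, pK, pU, pW, ell, hkp, numLevels, two_mul, Nat.add_assoc]

/-- The step-bound polynomial of the program. [folklore] -/
def costPoly : Polynomial ℕ :=
  let X : Polynomial ℕ := Polynomial.X
  let M := X + X
  (64 * X + 40) + 4 * ((900 * M + 5000 + 2) * M + 28 * M + 45 + 6 * M + 18) + (60 * X + 120)

/-- The step-bound polynomial evaluates to the step bound. [folklore] -/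
theorem costPoly_eval (s : ℕ) : costPoly.eval s = progCost s := by
  simp [costPoly, progCost, parseCost, trialCost, coreCost, stepCost]

/-- **Stage A2 is polynomial time: `stageA2 ∈ FP`** (`Com.mem_FP`, `StackPrograms.lean`).
[cite: AroraBarak2009, §1.3 (polynomial time on Turing machines; robustness)] -/
theorem stageA2_mem_FP : stageA2 ∈ FP :=
  Com.mem_FP prog (o .inp) (o .RES) costPoly stageA2 fun z => by
    obtain ⟨Rf, h, hout⟩ := runs_prog z
    exact ⟨Rf, Or.inl (by rw [costPoly_eval]; exact h), hout⟩

end Main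

end OFPostA2

end Literature.Computability.Cryptography

end
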